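import Literature.NumberTheory.LFunctions.ProlateExistsUnique
import HarnessLib

/-!
# The commutation step of the completeness of the even prolate functions of a general band `[−λ,λ]`:
# `[𝐖_λ, K_λ] = 0` and "even eigenvectors of the sinc operator are prolate"

LINE 1 — FRAMING: RH-FREE classical analysis (Slepian–Pollak 1961 §III at a general band `λ > 0`, Slepian
parameter `c = 2πλ²`: the commutation of the prolate differential operator
`𝐖_λ = −∂(λ²−x²)∂ + (2πλx)²` with the sinc-kernel integral operator on `L²([−λ,λ])` and the resulting
completeness step for the even prolate functions `h_{2n,λ}`); cell rh-crit, corpus C2 (dbl) — with the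
companion module `ProlateBandSincOperator` this supplies the ONE missing input `(h_C)` of the door
`Literature.Analysis.DeBrangesSpaces.Burnol2002.Burnol2002CRAS_lem3_of_complete` (Burnol 2002 CRAS Lemme 3 at a
general cutoff `λ`); bears_on: B-C (COLUMN 6 DBR) as corpus vocabulary only.  WHAT THIS IS NOT: any claim
about `ζ` or RH — nothing in this file bears on the truth of RH.

Topic `NumberTheory/LFunctions`; namespace `Literature.NumberTheory.LFunctions.ProlateBand`.  Theorems only
(no definition, no named fact, no instance, no `sorry`).

This is the GENERAL-BAND PORT of the tree's band-1 module
`Literature/NumberTheory/ConnesConsani2021/ProlateCommutation.lean` (Connes–Consani 2021 §4 p. 17 /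
Slepian–Pollak 1961 §III at `λ = 1`), statement by statement and proof by proof: `[−λ,λ] ↦ [−λ,λ]`,
`𝐖 = −∂(λ²−x²)∂ + (2πλx)² ↦ 𝐖_λ = −∂(λ²−x²)∂ + (2πλx)²` (the operator of the tree's predicate
`IsProlateFunction λ n`, Connes–Consani–Moscovici (7.5)), kernel `∫_{−λ}^{λ}e^{2πiξv}dξ ↦ ∫_{−λ}^{λ}e^{2πiξv}dξ`,
Frobenius solution `frobSol 1 χ ↦ frobSol λ χ` (the tree's general-`λ` principal solution, `u_χ(λ) = 1`),
and — the one structural change — the identification step concludes with "a multiple of SOME function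
satisfying `IsProlateFunction λ (2k)`" (`exists_eq_mul_prolate`) instead of the band-1 Frobenius objects
`prolateFun k`, so that the main theorem lands in the span of the set of `L²([−λ,λ])` classes of the
`IsProlateFunction λ (2n)` functions (written out explicitly; it is `ProlateBand.prolateBandSet λ` of the
companion module).  No scaling reduces band `λ` to band `1` (the time–band product is `λ²`, not `1`).

* Part A: differentiation under `∫_{−λ}^{λ}`, Green's symmetric identity for `𝐖_λ` on `[−λ,λ]` with NO
  boundary condition (`λ²−x²` kills the boundary terms) `integral_prolateW_mul_comm`, Slepian's commutation
  `prolateW_cosTransform_comm` (`𝐖_{λ,ξ} cos(2πxξ) = 𝐖_{λ,x} cos(2πxξ)`), and the sinc operator on even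
  functions as the iterated finite cosine transform (`integral_sinc_mul_eq_cos_cos`).
* Part B: band-limited functions `R₀D(y) = ∫_{−λ}^{λ} D(ξ)cos(2πξy)dξ`, the KEY identity
  `integral_cosTransform_WR_mul_cos` (`[𝐖_λ, C∘C] = 0`) and the symmetry `integral_conj_WR_mul_R0`.
* Part C: an even `C²` solution of the prolate equation on `(−λ,λ)` is a multiple of the Frobenius solution
  (`exists_eq_mul_frobSol`, Wronskian + Cauchy uniqueness at the regular singular point `x = λ`) and hence
  of an `IsProlateFunction λ (2k)` function (`exists_eq_mul_prolate`, via the tree's even-extension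
  normalisation as in `exists_isProlateFunction_of_frobSol`).
* Main theorem `even_eigenvector_mem_span_prolateBand`: on `F := E_ν ∩ {even}` (finite-dimensional for a
  compact `K`) the map `T ↦ ν⁻¹𝐖_λR₀ĈT` is a symmetric endomorphism; its eigenvectors solve `𝐖_λg = χg`
  pointwise, their real and imaginary parts are even `C²` solutions, hence multiples of prolate functions.

## References
* [SlepianPollak1961] D. Slepian, H. O. Pollak, *Prolate spheroidal wave functions, Fourier analysis and
  uncertainty — I*, Bell System Tech. J. 40 (1961) 43–63, §III (general `c`).
* [ConnesConsani2021] A. Connes, C. Consani, arXiv:2006.13771, §4 pp. 16–17 (the band-1 instance followed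
  here line by line).
* [ConnesConsaniMoscovici2025] (tree key) §7 (7.5), (7.9)–(7.12): the prolate axioms `IsProlateFunction`.
* [CoddingtonLevinson1955] Ch. 4 §8, Ch. 8 §1 (regular singular points, Wronskian).
-/

noncomputable section

open _root_.MeasureTheory Complex Set Filter
open scoped Real ComplexConjugate InnerProductSpace ENNReal Topology

namespace Literature.NumberTheory.LFunctions

namespace ProlateBand

variable {lam : ℝ}

/-! ### Differentiation under the integral sign, complex-valued densities -/

/-- `d/dω ∫_{−λ}^{λ} φ(x) cos(2πxω) dx = ∫ φ(x)(−2πx) sin(2πxω) dx` for `φ : ℝ → ℂ` continuous on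
`[−λ, λ]`. [folklore] -/
private theorem hasDerivAt_integral_mul_cosC (hlam : 0 < lam) {φ : ℝ → ℂ}
    (hφ : ContinuousOn φ (Icc (-lam) lam)) (ω₀ : ℝ) :
    HasDerivAt (fun ω : ℝ ↦ ∫ x in (-lam)..lam, φ x * (Real.cos (2 * π * x * ω) : ℂ))
      (∫ x in (-lam)..lam, φ x * ((-(2 * π * x) * Real.sin (2 * π * x * ω₀) : ℝ) : ℂ)) ω₀ := by
  have hle : -lam ≤ lam := by linarith
  have hIoc : uIoc (-lam) lam ⊆ Icc (-lam) lam := by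
    rw [uIoc_of_le hle]; exact Ioc_subset_Icc_self
  have hcontF : ∀ ω : ℝ, ContinuousOn (fun x : ℝ ↦ φ x * (Real.cos (2 * π * x * ω) : ℂ))
      (Icc (-lam) lam) := fun ω ↦ hφ.mul (by fun_prop)
  have hcontF' : ∀ ω : ℝ, ContinuousOn
      (fun x : ℝ ↦ φ x * ((-(2 * π * x) * Real.sin (2 * π * x * ω) : ℝ) : ℂ)) (Icc (-lam) lam) :=
    fun ω ↦ hφ.mul (by fun_prop)
  obtain ⟨C, hC⟩ := isCompact_Icc.exists_bound_of_continuousOn hφ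
  have key := intervalIntegral.hasDerivAt_integral_of_dominated_loc_of_deriv_le
    (μ := (volume : Measure ℝ)) (a := -lam) (b := lam) (x₀ := ω₀) (s := univ)
    (F := fun ω x ↦ φ x * (Real.cos (2 * π * x * ω) : ℂ))
    (F' := fun ω x ↦ φ x * ((-(2 * π * x) * Real.sin (2 * π * x * ω) : ℝ) : ℂ))
    (bound := fun _ ↦ C * (2 * π * lam)) univ_mem
    (Eventually.of_forall fun ω ↦ ((hcontF ω).mono hIoc).aestronglyMeasurable measurableSet_uIoc)
    ((hcontF ω₀).intervalIntegrable_of_Icc hle)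
    (((hcontF' ω₀).mono hIoc).aestronglyMeasurable measurableSet_uIoc)
    (Eventually.of_forall fun x hx ω _ ↦ by
      have hx' : x ∈ Icc (-lam) lam := hIoc hx
      rw [norm_mul, Complex.norm_real, Real.norm_eq_abs, abs_mul, abs_neg]
      have h1 : |2 * π * x| ≤ 2 * π * lam := by
        rw [abs_mul, abs_of_pos (by positivity : (0 : ℝ) < 2 * π)]
        have : |x| ≤ lam := abs_le.2 ⟨hx'.1, hx'.2⟩
        nlinarith [Real.pi_pos]
      have h2 : |Real.sin (2 * π * x * ω)| ≤ 1 := Real.abs_sin_le_one _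
      have h3 : ‖φ x‖ ≤ C := hC x hx'
      calc ‖φ x‖ * (|2 * π * x| * |Real.sin (2 * π * x * ω)|)
          ≤ C * (2 * π * lam * 1) := by
            gcongr
            · exact (norm_nonneg _).trans h3
        _ = C * (2 * π * lam) := by ring)
    intervalIntegrable_const
    (Eventually.of_forall fun x _ ω _ ↦ by
      have h := ((((hasDerivAt_id ω).const_mul (2 * π * x)).cos).ofReal_comp).const_mul (φ x)
      refine h.congr_deriv ?_
      simp only [id, mul_one]
      push_cast
      ring)
  exact key.2

/-- `d/dω ∫_{−λ}^{λ} φ(x) sin(2πxω) dx = ∫ φ(x)(2πx) cos(2πxω) dx` for `φ : ℝ → ℂ` continuous on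
`[−λ, λ]`. [folklore] -/
private theorem hasDerivAt_integral_mul_sinC (hlam : 0 < lam) {φ : ℝ → ℂ}
    (hφ : ContinuousOn φ (Icc (-lam) lam)) (ω₀ : ℝ) :
    HasDerivAt (fun ω : ℝ ↦ ∫ x in (-lam)..lam, φ x * (Real.sin (2 * π * x * ω) : ℂ))
      (∫ x in (-lam)..lam, φ x * (((2 * π * x) * Real.cos (2 * π * x * ω₀) : ℝ) : ℂ)) ω₀ := by
  have hle : -lam ≤ lam := by linarith
  have hIoc : uIoc (-lam) lam ⊆ Icc (-lam) lam := by
    rw [uIoc_of_le hle]; exact Ioc_subset_Icc_self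
  have hcontF : ∀ ω : ℝ, ContinuousOn (fun x : ℝ ↦ φ x * (Real.sin (2 * π * x * ω) : ℂ))
      (Icc (-lam) lam) := fun ω ↦ hφ.mul (by fun_prop)
  have hcontF' : ∀ ω : ℝ, ContinuousOn
      (fun x : ℝ ↦ φ x * (((2 * π * x) * Real.cos (2 * π * x * ω) : ℝ) : ℂ)) (Icc (-lam) lam) :=
    fun ω ↦ hφ.mul (by fun_prop)
  obtain ⟨C, hC⟩ := isCompact_Icc.exists_bound_of_continuousOn hφ
  have key := intervalIntegral.hasDerivAt_integral_of_dominated_loc_of_deriv_le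
    (μ := (volume : Measure ℝ)) (a := -lam) (b := lam) (x₀ := ω₀) (s := univ)
    (F := fun ω x ↦ φ x * (Real.sin (2 * π * x * ω) : ℂ))
    (F' := fun ω x ↦ φ x * (((2 * π * x) * Real.cos (2 * π * x * ω) : ℝ) : ℂ))
    (bound := fun _ ↦ C * (2 * π * lam)) univ_mem
    (Eventually.of_forall fun ω ↦ ((hcontF ω).mono hIoc).aestronglyMeasurable measurableSet_uIoc)
    ((hcontF ω₀).intervalIntegrable_of_Icc hle)
    (((hcontF' ω₀).mono hIoc).aestronglyMeasurable measurableSet_uIoc)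
    (Eventually.of_forall fun x hx ω _ ↦ by
      have hx' : x ∈ Icc (-lam) lam := hIoc hx
      rw [norm_mul, Complex.norm_real, Real.norm_eq_abs, abs_mul]
      have h1 : |2 * π * x| ≤ 2 * π * lam := by
        rw [abs_mul, abs_of_pos (by positivity : (0 : ℝ) < 2 * π)]
        have : |x| ≤ lam := abs_le.2 ⟨hx'.1, hx'.2⟩
        nlinarith [Real.pi_pos]
      have h2 : |Real.cos (2 * π * x * ω)| ≤ 1 := Real.abs_cos_le_one _
      have h3 : ‖φ x‖ ≤ C := hC x hx'
      calc ‖φ x‖ * (|2 * π * x| * |Real.cos (2 * π * x * ω)|)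
          ≤ C * (2 * π * lam * 1) := by
            gcongr
            · exact (norm_nonneg _).trans h3
        _ = C * (2 * π * lam) := by ring)
    intervalIntegrable_const
    (Eventually.of_forall fun x _ ω _ ↦ by
      have h := ((((hasDerivAt_id ω).const_mul (2 * π * x)).sin).ofReal_comp).const_mul (φ x)
      refine h.congr_deriv ?_
      simp only [id, mul_one]
      push_cast
      ring)
  exact key.2

/-! ### Green's symmetric identity for `𝐖 = −∂(λ²−x²)∂ + (2πλx)²` on `[−λ, λ]` (complex valued) -/

/-- **`∫_{−λ}^{λ} (𝐖u) v = ∫_{−λ}^{λ} u (𝐖v)`** for `u, v ∈ C²[−λ,λ]` (complex valued), with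
`𝐖u = −((λ²−x²)u′)′ + (2πλx)²u = 2x u′ − (λ²−x²)u″ + (2πλx)²u` written through derivative data; the
boundary terms vanish because `1 − x² = 0` at `±1`. [cite: ConnesConsani2021, §4 p. 16 eq. (WLambdaq); SlepianPollak1961, §III] -/
theorem integral_prolateW_mul_comm (hlam : 0 < lam) {u u₁ u₂ v v₁ v₂ : ℝ → ℂ}
    (hu : ∀ x ∈ Icc (-lam) lam, HasDerivAt u (u₁ x) x) (hu₁ : ∀ x ∈ Icc (-lam) lam, HasDerivAt u₁ (u₂ x) x)
    (hv : ∀ x ∈ Icc (-lam) lam, HasDerivAt v (v₁ x) x) (hv₁ : ∀ x ∈ Icc (-lam) lam, HasDerivAt v₁ (v₂ x) x)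
    (hu₂ : ContinuousOn u₂ (Icc (-lam) lam)) (hv₂ : ContinuousOn v₂ (Icc (-lam) lam)) :
    ∫ x in (-lam)..lam,
        (2 * x * u₁ x - ((lam : ℂ) ^ 2 - (x : ℂ) ^ 2) * u₂ x + (2 * π * lam * x) ^ 2 * u x) * v x
      = ∫ x in (-lam)..lam,
        u x * (2 * x * v₁ x - ((lam : ℂ) ^ 2 - (x : ℂ) ^ 2) * v₂ x + (2 * π * lam * x) ^ 2 * v x) := by
  have hle : -lam ≤ lam := by linarith
  have huc : ContinuousOn u (Icc (-lam) lam) := fun x hx ↦ (hu x hx).continuousAt.continuousWithinAt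
  have hu₁c : ContinuousOn u₁ (Icc (-lam) lam) :=
    fun x hx ↦ (hu₁ x hx).continuousAt.continuousWithinAt
  have hvc : ContinuousOn v (Icc (-lam) lam) := fun x hx ↦ (hv x hx).continuousAt.continuousWithinAt
  have hv₁c : ContinuousOn v₁ (Icc (-lam) lam) :=
    fun x hx ↦ (hv₁ x hx).continuousAt.continuousWithinAt
  -- `B = (1 − x²)(u₁ v − u v₁)`, `B' = −(𝐖u) v + u (𝐖v)` (the `(2πλx)²` terms cancel)
  set B : ℝ → ℂ := fun x ↦ ((lam : ℂ) ^ 2 - (x : ℂ) ^ 2) * (u₁ x * v x - u x * v₁ x) with hB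
  set b : ℝ → ℂ := fun x ↦
    u x * (2 * x * v₁ x - ((lam : ℂ) ^ 2 - (x : ℂ) ^ 2) * v₂ x + (2 * π * lam * x) ^ 2 * v x)
      - (2 * x * u₁ x - ((lam : ℂ) ^ 2 - (x : ℂ) ^ 2) * u₂ x + (2 * π * lam * x) ^ 2 * u x) * v x with hb
  have hBc : ContinuousOn B (Icc (-lam) lam) := by
    rw [hB]
    exact (by fun_prop : Continuous fun x : ℝ ↦ ((lam : ℂ) ^ 2 - (x : ℂ) ^ 2)).continuousOn.mul
      ((hu₁c.mul hvc).sub (huc.mul hv₁c))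
  have hBd : ∀ x ∈ Ioo (-lam) lam, HasDerivAt B (b x) x := by
    intro x hx
    have hx' : x ∈ Icc (-lam) lam := Ioo_subset_Icc_self hx
    have hp : HasDerivAt (fun y : ℝ ↦ ((lam : ℂ) ^ 2 - (y : ℂ) ^ 2)) (-(2 * (x : ℂ))) x := by
      have := ((hasDerivAt_id x).ofReal_comp.pow 2).const_sub ((lam : ℂ) ^ 2)
      refine this.congr_deriv ?_
      simp only [id]; push_cast; ring
    have h := hp.mul (((hu₁ x hx').mul (hv x hx')).sub ((hu x hx').mul (hv₁ x hx')))
    refine h.congr_deriv ?_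
    simp only [hb, Pi.mul_apply, Pi.sub_apply]
    ring
  have hbc : ContinuousOn b (Icc (-lam) lam) := by
    rw [hb]
    apply ContinuousOn.sub
    · exact huc.mul ((((by fun_prop : Continuous fun x : ℝ ↦ (2 * (x : ℂ))).continuousOn.mul hv₁c).sub
        ((by fun_prop : Continuous fun x : ℝ ↦ ((lam : ℂ) ^ 2 - (x : ℂ) ^ 2)).continuousOn.mul hv₂)).add
        ((by fun_prop : Continuous fun x : ℝ ↦ (2 * π * lam * (x : ℂ)) ^ 2).continuousOn.mul hvc))
    · exact ((((by fun_prop : Continuous fun x : ℝ ↦ (2 * (x : ℂ))).continuousOn.mul hu₁c).sub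
        ((by fun_prop : Continuous fun x : ℝ ↦ ((lam : ℂ) ^ 2 - (x : ℂ) ^ 2)).continuousOn.mul hu₂)).add
        ((by fun_prop : Continuous fun x : ℝ ↦ (2 * π * lam * (x : ℂ)) ^ 2).continuousOn.mul huc)).mul hvc
  have hint := intervalIntegral.integral_eq_sub_of_hasDerivAt_of_le hle hBc hBd
    (hbc.intervalIntegrable_of_Icc hle)
  have hB1 : B lam = 0 := by simp [hB]
  have hB0 : B (-lam) = 0 := by simp [hB]
  rw [hB1, hB0, sub_zero] at hint
  -- `∫ b = 0`, and `b = u 𝐖v − (𝐖u) v`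
  have hI1 : IntervalIntegrable (fun x ↦
      u x * (2 * x * v₁ x - ((lam : ℂ) ^ 2 - (x : ℂ) ^ 2) * v₂ x + (2 * π * lam * x) ^ 2 * v x)) volume (-lam) lam :=
    (huc.mul ((((by fun_prop : Continuous fun x : ℝ ↦ (2 * (x : ℂ))).continuousOn.mul hv₁c).sub
        ((by fun_prop : Continuous fun x : ℝ ↦ ((lam : ℂ) ^ 2 - (x : ℂ) ^ 2)).continuousOn.mul hv₂)).add
        ((by fun_prop : Continuous fun x : ℝ ↦ (2 * π * lam * (x : ℂ)) ^ 2).continuousOn.mul hvc))).intervalIntegrable_of_Icc hle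
  have hI2 : IntervalIntegrable (fun x ↦
      (2 * x * u₁ x - ((lam : ℂ) ^ 2 - (x : ℂ) ^ 2) * u₂ x + (2 * π * lam * x) ^ 2 * u x) * v x) volume (-lam) lam :=
    (((((by fun_prop : Continuous fun x : ℝ ↦ (2 * (x : ℂ))).continuousOn.mul hu₁c).sub
        ((by fun_prop : Continuous fun x : ℝ ↦ ((lam : ℂ) ^ 2 - (x : ℂ) ^ 2)).continuousOn.mul hu₂)).add
        ((by fun_prop : Continuous fun x : ℝ ↦ (2 * π * lam * (x : ℂ)) ^ 2).continuousOn.mul huc)).mul hvc).intervalIntegrable_of_Icc hle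
  have hsplit : ∫ x in (-lam)..lam, b x =
      (∫ x in (-lam)..lam, u x * (2 * x * v₁ x - ((lam : ℂ) ^ 2 - (x : ℂ) ^ 2) * v₂ x + (2 * π * lam * x) ^ 2 * v x))
        - ∫ x in (-lam)..lam,
          (2 * x * u₁ x - ((lam : ℂ) ^ 2 - (x : ℂ) ^ 2) * u₂ x + (2 * π * lam * x) ^ 2 * u x) * v x := by
    rw [← intervalIntegral.integral_sub hI1 hI2]
  rw [hsplit] at hint
  exact (sub_eq_zero.mp hint).symm

/-! ### The commutation `𝐖 ∘ C = C ∘ 𝐖` for the finite cosine transform `(Cφ)(ξ) = ∫_{−λ}^{λ} φ(x)cos(2πxξ)dx` -/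

/-- **Slepian's commutation ("lucky accident") for the finite cosine transform**: for `φ ∈ C²[−λ,λ]`
(complex valued) and every real `ξ`, `𝐖_ξ (Cφ)(ξ) = (C 𝐖φ)(ξ)`, where `(Cφ)(ξ) = ∫_{−λ}^{λ} φ(x)cos(2πxξ)dx`,
`𝐖 = −∂(λ²−x²)∂ + (2πλx)²`, the `ξ`-derivatives of `Cφ` being the differentiated integrals.  Proof as
printed: `𝐖_x cos(2πxξ) = 𝐖_ξ cos(2πxξ)` and Green's identity. [cite: SlepianPollak1961, §III; ConnesConsani2021, §4 p. 16 eq. (prolateeq)] -/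
theorem prolateW_cosTransform_comm (hlam : 0 < lam) {φ φ₁ φ₂ : ℝ → ℂ}
    (hφ : ∀ x ∈ Icc (-lam) lam, HasDerivAt φ (φ₁ x) x)
    (hφ₁ : ∀ x ∈ Icc (-lam) lam, HasDerivAt φ₁ (φ₂ x) x)
    (hφ₂ : ContinuousOn φ₂ (Icc (-lam) lam)) (ξ : ℝ) :
    2 * (ξ : ℂ) * (∫ x in (-lam)..lam, φ x * ((-(2 * π * x) * Real.sin (2 * π * x * ξ) : ℝ) : ℂ))
      - ((lam : ℂ) ^ 2 - (ξ : ℂ) ^ 2) * (∫ x in (-lam)..lam,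
          (φ x * ((-(2 * π * x) : ℝ) : ℂ)) * (((2 * π * x) * Real.cos (2 * π * x * ξ) : ℝ) : ℂ))
      + (2 * π * lam * (ξ : ℂ)) ^ 2 * (∫ x in (-lam)..lam, φ x * (Real.cos (2 * π * x * ξ) : ℂ))
    = ∫ x in (-lam)..lam,
        (2 * x * φ₁ x - ((lam : ℂ) ^ 2 - (x : ℂ) ^ 2) * φ₂ x + (2 * π * lam * x) ^ 2 * φ x)
          * (Real.cos (2 * π * x * ξ) : ℂ) := by
  have hle : -lam ≤ lam := by linarith
  have hφc : ContinuousOn φ (Icc (-lam) lam) := fun x hx ↦ (hφ x hx).continuousAt.continuousWithinAt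
  have hφ₁c : ContinuousOn φ₁ (Icc (-lam) lam) :=
    fun x hx ↦ (hφ₁ x hx).continuousAt.continuousWithinAt
  -- the kernel `u(x) = cos(2πxξ)` and its derivatives
  have hu : ∀ x ∈ Icc (-lam) lam, HasDerivAt (fun y : ℝ ↦ (Real.cos (2 * π * y * ξ) : ℂ))
      (((-(2 * π * ξ) * Real.sin (2 * π * x * ξ) : ℝ) : ℂ)) x := by
    intro x _
    have h := ((((hasDerivAt_id x).const_mul (2 * π)).mul_const ξ).cos).ofReal_comp
    refine h.congr_deriv ?_
    simp only [id]; push_cast; ring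
  have hu₁ : ∀ x ∈ Icc (-lam) lam, HasDerivAt (fun y : ℝ ↦ ((-(2 * π * ξ) * Real.sin (2 * π * y * ξ) : ℝ) : ℂ))
      (((-(2 * π * ξ) ^ 2 * Real.cos (2 * π * x * ξ) : ℝ) : ℂ)) x := by
    intro x _
    have h := (((((hasDerivAt_id x).const_mul (2 * π)).mul_const ξ).sin).const_mul (-(2 * π * ξ))).ofReal_comp
    refine h.congr_deriv ?_
    simp only [id]; push_cast; ring
  have hu₂c : ContinuousOn (fun x : ℝ ↦ ((-(2 * π * ξ) ^ 2 * Real.cos (2 * π * x * ξ) : ℝ) : ℂ))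
      (Icc (-lam) lam) := by fun_prop
  have hG := integral_prolateW_mul_comm hlam hu hu₁ hφ hφ₁ hu₂c hφ₂
  -- the three differentiated integrals
  have hIa : IntervalIntegrable
      (fun x : ℝ ↦ φ x * ((-(2 * π * x) * Real.sin (2 * π * x * ξ) : ℝ) : ℂ)) volume (-lam) lam :=
    (hφc.mul (by fun_prop)).intervalIntegrable_of_Icc hle
  have hIb : IntervalIntegrable (fun x : ℝ ↦
      (φ x * ((-(2 * π * x) : ℝ) : ℂ)) * (((2 * π * x) * Real.cos (2 * π * x * ξ) : ℝ) : ℂ)) volume (-lam) lam :=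
    ((hφc.mul (by fun_prop)).mul (by fun_prop)).intervalIntegrable_of_Icc hle
  have hIc : IntervalIntegrable (fun x : ℝ ↦ φ x * (Real.cos (2 * π * x * ξ) : ℂ)) volume (-lam) lam :=
    (hφc.mul (by fun_prop)).intervalIntegrable_of_Icc hle
  rw [← intervalIntegral.integral_const_mul, ← intervalIntegral.integral_const_mul,
    ← intervalIntegral.integral_const_mul, ← intervalIntegral.integral_sub (hIa.const_mul _) (hIb.const_mul _),
    ← intervalIntegral.integral_add ((hIa.const_mul _).sub (hIb.const_mul _)) (hIc.const_mul _)]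
  calc ∫ x in (-lam)..lam,
        2 * (ξ : ℂ) * (φ x * ((-(2 * π * x) * Real.sin (2 * π * x * ξ) : ℝ) : ℂ))
          - ((lam : ℂ) ^ 2 - (ξ : ℂ) ^ 2) * ((φ x * ((-(2 * π * x) : ℝ) : ℂ)) * (((2 * π * x) * Real.cos (2 * π * x * ξ) : ℝ) : ℂ))
          + (2 * π * lam * (ξ : ℂ)) ^ 2 * (φ x * (Real.cos (2 * π * x * ξ) : ℂ))
      = ∫ x in (-lam)..lam,
          (2 * x * (((-(2 * π * ξ) * Real.sin (2 * π * x * ξ) : ℝ) : ℂ))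
            - ((lam : ℂ) ^ 2 - (x : ℂ) ^ 2) * (((-(2 * π * ξ) ^ 2 * Real.cos (2 * π * x * ξ) : ℝ) : ℂ))
            + (2 * π * lam * x) ^ 2 * (Real.cos (2 * π * x * ξ) : ℂ)) * φ x := by
        refine intervalIntegral.integral_congr fun x _ ↦ ?_
        push_cast
        ring
    _ = ∫ x in (-lam)..lam, (Real.cos (2 * π * x * ξ) : ℂ)
          * (2 * x * φ₁ x - ((lam : ℂ) ^ 2 - (x : ℂ) ^ 2) * φ₂ x + (2 * π * lam * x) ^ 2 * φ x) := hG
    _ = _ := intervalIntegral.integral_congr fun x _ ↦ by ring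

/-! ### Parity: odd moments of an even function on `[−λ, λ]` vanish -/

/-- For `S` even a.e. on `[−λ,λ]`: `∫_{[−λ,λ]} S(x) sin(2πxξ) dx = 0`. [folklore] -/
private theorem integral_Icc_mul_sin_eq_zero_of_even (hlam : 0 < lam) {S : ℝ → ℂ}
    (heven : ∀ᵐ x ∂((volume : Measure ℝ).restrict (Icc (-lam) lam)), S (-x) = S x) (ξ : ℝ) :
    ∫ x in Icc (-lam) lam, S x * (Real.sin (2 * π * x * ξ) : ℂ) = 0 := by
  have hle : -lam ≤ lam := by linarith
  rw [integral_Icc_eq_integral_Ioc, ← intervalIntegral.integral_of_le hle]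
  have h1 : (∫ x in (-lam)..lam, S (-x) * (Real.sin (2 * π * (-x) * ξ) : ℂ))
      = ∫ x in (-lam)..lam, S x * (Real.sin (2 * π * x * ξ) : ℂ) := by
    simpa only [neg_neg] using intervalIntegral.integral_comp_neg (a := -lam) (b := lam)
      (fun x ↦ S x * (Real.sin (2 * π * x * ξ) : ℂ))
  have h2 : (∫ x in (-lam)..lam, S (-x) * (Real.sin (2 * π * (-x) * ξ) : ℂ))
      = -∫ x in (-lam)..lam, S x * (Real.sin (2 * π * x * ξ) : ℂ) := by
    rw [← intervalIntegral.integral_neg]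
    refine intervalIntegral.integral_congr_ae ?_
    have heven' : ∀ᵐ x ∂(volume : Measure ℝ), x ∈ Icc (-lam) lam → S (-x) = S x :=
      (ae_restrict_iff' measurableSet_Icc).1 heven
    filter_upwards [heven'] with x hx hxI
    have hx' : x ∈ Icc (-lam) lam := by
      rw [uIoc_of_le hle] at hxI
      exact Ioc_subset_Icc_self hxI
    rw [hx hx', show 2 * π * (-x) * ξ = -(2 * π * x * ξ) by ring, Real.sin_neg]
    push_cast
    ring
  have h := h1.symm.trans h2
  -- `I = −I`
  have : (2 : ℂ) * ∫ x in (-lam)..lam, S x * (Real.sin (2 * π * x * ξ) : ℂ) = 0 := by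
    linear_combination h
  simpa using this

/-- The sinc kernel is a cosine integral: `∫_{−λ}^{λ} e^{2πiξv} dξ = ∫_{−λ}^{λ} cos(2πξv) dξ`. [folklore] -/
private theorem integral_cexp_eq_integral_cos (v : ℝ) :
    ∫ ξ in (-lam)..lam, cexp (2 * π * I * ξ * v) = ∫ ξ in (-lam)..lam, (Real.cos (2 * π * ξ * v) : ℂ) := by
  have e : (fun ξ : ℝ ↦ cexp (2 * π * I * ξ * v))
      = fun ξ : ℝ ↦ (Real.cos (2 * π * ξ * v) : ℂ) + (Real.sin (2 * π * ξ * v) : ℂ) * I := by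
    funext ξ
    have : (2 * π * I * ξ * v : ℂ) = ((2 * π * ξ * v : ℝ) : ℂ) * I := by push_cast; ring
    rw [this, Complex.exp_mul_I, ← Complex.ofReal_cos, ← Complex.ofReal_sin]
  have hsin : ∫ ξ in (-lam)..lam, (Real.sin (2 * π * ξ * v) : ℂ) * I = 0 := by
    rw [intervalIntegral.integral_mul_const]
    have h1 : (∫ ξ in (-lam)..lam, (Real.sin (2 * π * (-ξ) * v) : ℂ))
        = ∫ ξ in (-lam)..lam, (Real.sin (2 * π * ξ * v) : ℂ) := by
      simpa only [neg_neg] using intervalIntegral.integral_comp_neg (a := -lam) (b := lam)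
        (fun ξ ↦ (Real.sin (2 * π * ξ * v) : ℂ))
    have h2 : (∫ ξ in (-lam)..lam, (Real.sin (2 * π * (-ξ) * v) : ℂ))
        = -∫ ξ in (-lam)..lam, (Real.sin (2 * π * ξ * v) : ℂ) := by
      rw [← intervalIntegral.integral_neg]
      refine intervalIntegral.integral_congr fun ξ _ ↦ ?_
      rw [show 2 * π * (-ξ) * v = -(2 * π * ξ * v) by ring, Real.sin_neg]
      push_cast
      ring
    have : (2 : ℂ) * ∫ ξ in (-lam)..lam, (Real.sin (2 * π * ξ * v) : ℂ) = 0 := by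
      linear_combination h1.symm.trans h2
    have h0 : ∫ ξ in (-lam)..lam, (Real.sin (2 * π * ξ * v) : ℂ) = 0 := by simpa using this
    rw [h0, zero_mul]
  rw [e, intervalIntegral.integral_add (by apply Continuous.intervalIntegrable; fun_prop)
    (by apply Continuous.intervalIntegrable; fun_prop), hsin, add_zero]

/-! ### `K = C ∘ C` on even functions: the cosine representation of the sinc operator -/

/-- **For `S ∈ L¹[−λ,λ]` even: `∫_{[−λ,λ]} κ(y − x) S(x) dx = ∫_{−λ}^{λ} cos(2πξy) Ĉ_S(ξ) dξ`** with
`κ(v) = ∫_{−λ}^{λ} e^{2πiξv}dξ` the sinc kernel and `Ĉ_S(ξ) = ∫_{[−λ,λ]} S(x)cos(2πxξ)dx` (Fubini and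
parity). [cite: ConnesConsani2021, §4 p. 16 eq. (prolateeq); SlepianPollak1961, §III] -/
theorem integral_sinc_mul_eq_cos_cos (hlam : 0 < lam) {S : ℝ → ℂ} (hS : IntegrableOn S (Icc (-lam) lam))
    (heven : ∀ᵐ x ∂((volume : Measure ℝ).restrict (Icc (-lam) lam)), S (-x) = S x) (y : ℝ) :
    ∫ x in Icc (-lam) lam, (∫ ξ in (-lam)..lam, cexp (2 * π * I * ξ * ((y - x : ℝ) : ℂ))) * S x
      = ∫ ξ in (-lam)..lam, (Real.cos (2 * π * ξ * y) : ℂ)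
          * ∫ x in Icc (-lam) lam, S x * (Real.cos (2 * π * x * ξ) : ℂ) := by
  have hle : -lam ≤ lam := by linarith
  -- rewrite the kernel through cosines and expand `cos(2πξ(y − x))`
  have hker : ∀ x : ℝ, (∫ ξ in (-lam)..lam, cexp (2 * π * I * ξ * ((y - x : ℝ) : ℂ))) * S x
      = ∫ ξ in (-lam)..lam, ((Real.cos (2 * π * ξ * y) : ℂ) * (S x * (Real.cos (2 * π * x * ξ) : ℂ))
          + (Real.sin (2 * π * ξ * y) : ℂ) * (S x * (Real.sin (2 * π * x * ξ) : ℂ))) := by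
    intro x
    rw [integral_cexp_eq_integral_cos, ← intervalIntegral.integral_mul_const]
    refine intervalIntegral.integral_congr fun ξ _ ↦ ?_
    show (Real.cos (2 * π * ξ * (y - x)) : ℂ) * S x = _
    rw [show 2 * π * ξ * (y - x) = 2 * π * ξ * y - 2 * π * x * ξ by ring, Real.cos_sub]
    push_cast
    ring
  simp_rw [hker]
  -- Fubini on `[−λ,λ] × [−λ,λ]`
  set ν : Measure ℝ := (volume : Measure ℝ).restrict (Ioc (-lam) lam) with hν
  set μ : Measure ℝ := (volume : Measure ℝ).restrict (Icc (-lam) lam) with hμ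
  haveI : IsFiniteMeasure ν := by rw [hν]; exact isFiniteMeasure_restrict.2 measure_Ioc_lt_top.ne
  haveI : IsFiniteMeasure μ := by rw [hμ]; exact isFiniteMeasure_restrict.2 measure_Icc_lt_top.ne
  have hSμ : Integrable S μ := hS
  set F : ℝ → ℝ → ℂ := fun x ξ ↦ (Real.cos (2 * π * ξ * y) : ℂ) * (S x * (Real.cos (2 * π * x * ξ) : ℂ))
      + (Real.sin (2 * π * ξ * y) : ℂ) * (S x * (Real.sin (2 * π * x * ξ) : ℂ)) with hF
  have hFint : Integrable (Function.uncurry F) (μ.prod ν) := by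
    refine Integrable.mono' ((hSμ.comp_fst ν).norm.add (hSμ.comp_fst ν).norm) ?_ ?_
    · have hSm : AEStronglyMeasurable (fun p : ℝ × ℝ ↦ S p.1) (μ.prod ν) :=
        hSμ.aestronglyMeasurable.comp_quasiMeasurePreserving (Measure.quasiMeasurePreserving_fst)
      have h1 : AEStronglyMeasurable (fun p : ℝ × ℝ ↦ (Real.cos (2 * π * p.2 * y) : ℂ)) (μ.prod ν) :=
        (by fun_prop : Continuous fun p : ℝ × ℝ ↦ (Real.cos (2 * π * p.2 * y) : ℂ)).aestronglyMeasurable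
      have h2 : AEStronglyMeasurable (fun p : ℝ × ℝ ↦ (Real.cos (2 * π * p.1 * p.2) : ℂ)) (μ.prod ν) :=
        (by fun_prop : Continuous fun p : ℝ × ℝ ↦ (Real.cos (2 * π * p.1 * p.2) : ℂ)).aestronglyMeasurable
      have h3 : AEStronglyMeasurable (fun p : ℝ × ℝ ↦ (Real.sin (2 * π * p.2 * y) : ℂ)) (μ.prod ν) :=
        (by fun_prop : Continuous fun p : ℝ × ℝ ↦ (Real.sin (2 * π * p.2 * y) : ℂ)).aestronglyMeasurable
      have h4 : AEStronglyMeasurable (fun p : ℝ × ℝ ↦ (Real.sin (2 * π * p.1 * p.2) : ℂ)) (μ.prod ν) :=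
        (by fun_prop : Continuous fun p : ℝ × ℝ ↦ (Real.sin (2 * π * p.1 * p.2) : ℂ)).aestronglyMeasurable
      exact (h1.mul (hSm.mul h2)).add (h3.mul (hSm.mul h4))
    · refine Eventually.of_forall fun p ↦ ?_
      simp only [Function.uncurry, hF, Pi.add_apply]
      refine (norm_add_le _ _).trans (add_le_add ?_ ?_)
      · rw [norm_mul, norm_mul, Complex.norm_real, Complex.norm_real]
        have ha : ‖Real.cos (2 * π * p.2 * y)‖ ≤ 1 := Real.abs_cos_le_one _
        have hb : ‖Real.cos (2 * π * p.1 * p.2)‖ ≤ 1 := Real.abs_cos_le_one _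
        calc ‖Real.cos (2 * π * p.2 * y)‖ * (‖S p.1‖ * ‖Real.cos (2 * π * p.1 * p.2)‖)
            ≤ 1 * (‖S p.1‖ * 1) := by gcongr
          _ = ‖S p.1‖ := by ring
      · rw [norm_mul, norm_mul, Complex.norm_real, Complex.norm_real]
        have ha : ‖Real.sin (2 * π * p.2 * y)‖ ≤ 1 := Real.abs_sin_le_one _
        have hb : ‖Real.sin (2 * π * p.1 * p.2)‖ ≤ 1 := Real.abs_sin_le_one _
        calc ‖Real.sin (2 * π * p.2 * y)‖ * (‖S p.1‖ * ‖Real.sin (2 * π * p.1 * p.2)‖)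
            ≤ 1 * (‖S p.1‖ * 1) := by gcongr
          _ = ‖S p.1‖ := by ring
  have hswap := MeasureTheory.integral_integral_swap hFint
  have hcosI : ∀ ξ : ℝ, Integrable (fun x ↦ S x * (Real.cos (2 * π * x * ξ) : ℂ)) μ := fun ξ ↦
    hSμ.mul_bdd (c := 1) (by fun_prop : Continuous fun x : ℝ ↦ (Real.cos (2 * π * x * ξ) : ℂ)).aestronglyMeasurable
      (Eventually.of_forall fun x ↦ by rw [Complex.norm_real]; exact Real.abs_cos_le_one _)
  have hsinI : ∀ ξ : ℝ, Integrable (fun x ↦ S x * (Real.sin (2 * π * x * ξ) : ℂ)) μ := fun ξ ↦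
    hSμ.mul_bdd (c := 1) (by fun_prop : Continuous fun x : ℝ ↦ (Real.sin (2 * π * x * ξ) : ℂ)).aestronglyMeasurable
      (Eventually.of_forall fun x ↦ by rw [Complex.norm_real]; exact Real.abs_sin_le_one _)
  -- `∫_x ∫_ξ F = ∫_ξ ∫_x F`
  have hL : ∫ x in Icc (-lam) lam, (∫ ξ in (-lam)..lam, F x ξ) = ∫ x, (∫ ξ, F x ξ ∂ν) ∂μ := by
    rw [hμ]
    refine integral_congr_ae (Eventually.of_forall fun x ↦ ?_)
    simp only
    rw [intervalIntegral.integral_of_le hle]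
  have hR : ∫ ξ in (-lam)..lam, (Real.cos (2 * π * ξ * y) : ℂ)
        * ∫ x in Icc (-lam) lam, S x * (Real.cos (2 * π * x * ξ) : ℂ)
      = ∫ ξ, (∫ x, F x ξ ∂μ) ∂ν := by
    rw [intervalIntegral.integral_of_le hle]
    refine integral_congr_ae (Eventually.of_forall fun ξ ↦ ?_)
    simp only [hF]
    rw [integral_add ((hcosI ξ).const_mul _) ((hsinI ξ).const_mul _), integral_const_mul,
      integral_const_mul]
    have h0 : ∫ x, S x * (Real.sin (2 * π * x * ξ) : ℂ) ∂μ = 0 := by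
      rw [hμ]; exact integral_Icc_mul_sin_eq_zero_of_even hlam heven ξ
    rw [h0, mul_zero, add_zero, hμ]
  rw [hL, hswap, ← hR]


/-! ## Part B (analysis): band-limited functions `R₀D(y) = ∫_{−λ}^{λ} D(ξ)cos(2πξy)dξ` and `𝐖` -/

section BandLimited

variable {D : ℝ → ℂ}

/-- `R₀D` has derivative `R₁D`. [folklore] -/
private theorem hasDerivAt_R0 (hlam : 0 < lam) (hD : Continuous D) (y : ℝ) :
    HasDerivAt (fun y : ℝ ↦ ∫ ξ in (-lam)..lam, D ξ * (Real.cos (2 * π * ξ * y) : ℂ))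
      (∫ ξ in (-lam)..lam, D ξ * ((-(2 * π * ξ) * Real.sin (2 * π * ξ * y) : ℝ) : ℂ)) y :=
  hasDerivAt_integral_mul_cosC hlam hD.continuousOn y

/-- `R₁D` has derivative `R₂D`. [folklore] -/
private theorem hasDerivAt_R1 (hlam : 0 < lam) (hD : Continuous D) (y : ℝ) :
    HasDerivAt (fun y : ℝ ↦ ∫ ξ in (-lam)..lam, D ξ * ((-(2 * π * ξ) * Real.sin (2 * π * ξ * y) : ℝ) : ℂ))
      (∫ ξ in (-lam)..lam, (D ξ * ((-(2 * π * ξ) : ℝ) : ℂ)) * (((2 * π * ξ) * Real.cos (2 * π * ξ * y) : ℝ) : ℂ)) y := by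
  have hD' : Continuous fun ξ : ℝ ↦ D ξ * ((-(2 * π * ξ) : ℝ) : ℂ) := by fun_prop
  have h := hasDerivAt_integral_mul_sinC hlam hD'.continuousOn y
  have e : (fun y : ℝ ↦ ∫ ξ in (-lam)..lam, D ξ * ((-(2 * π * ξ) * Real.sin (2 * π * ξ * y) : ℝ) : ℂ))
      = fun y : ℝ ↦ ∫ ξ in (-lam)..lam, (D ξ * ((-(2 * π * ξ) : ℝ) : ℂ)) * (Real.sin (2 * π * ξ * y) : ℂ) := by
    funext y
    refine intervalIntegral.integral_congr fun ξ _ ↦ ?_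
    push_cast; ring
  rw [e]
  exact h

/-- `R₂D` is continuous (indeed differentiable). [folklore] -/
private theorem continuous_R2 (hlam : 0 < lam) (hD : Continuous D) :
    Continuous fun y : ℝ ↦ ∫ ξ in (-lam)..lam,
      (D ξ * ((-(2 * π * ξ) : ℝ) : ℂ)) * (((2 * π * ξ) * Real.cos (2 * π * ξ * y) : ℝ) : ℂ) := by
  have hD' : Continuous fun ξ : ℝ ↦ D ξ * ((-(2 * π * ξ) : ℝ) : ℂ) * (((2 * π * ξ) : ℝ) : ℂ) := by fun_prop
  have e : (fun y : ℝ ↦ ∫ ξ in (-lam)..lam,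
      (D ξ * ((-(2 * π * ξ) : ℝ) : ℂ)) * (((2 * π * ξ) * Real.cos (2 * π * ξ * y) : ℝ) : ℂ))
      = fun y : ℝ ↦ ∫ ξ in (-lam)..lam,
          (D ξ * ((-(2 * π * ξ) : ℝ) : ℂ) * (((2 * π * ξ) : ℝ) : ℂ)) * (Real.cos (2 * π * ξ * y) : ℂ) := by
    funext y
    refine intervalIntegral.integral_congr fun ξ _ ↦ ?_
    push_cast; ring
  rw [e]
  exact continuous_iff_continuousAt.2 fun y ↦
    (hasDerivAt_integral_mul_cosC hlam hD'.continuousOn y).continuousAt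

/-- Continuity of `R₀D`, `R₁D`. [folklore] -/
private theorem continuous_R0 (hlam : 0 < lam) (hD : Continuous D) :
    Continuous fun y : ℝ ↦ ∫ ξ in (-lam)..lam, D ξ * (Real.cos (2 * π * ξ * y) : ℂ) :=
  continuous_iff_continuousAt.2 fun y ↦ (hasDerivAt_R0 hlam hD y).continuousAt

/-- Continuity of `R₁D`. [folklore] -/
private theorem continuous_R1 (hlam : 0 < lam) (hD : Continuous D) :
    Continuous fun y : ℝ ↦ ∫ ξ in (-lam)..lam, D ξ * ((-(2 * π * ξ) * Real.sin (2 * π * ξ * y) : ℝ) : ℂ) :=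
  continuous_iff_continuousAt.2 fun y ↦ (hasDerivAt_R1 hlam hD y).continuousAt

/-- `𝐖(R₀D)` is continuous. [folklore] -/
private theorem continuous_WR (hlam : 0 < lam) (hD : Continuous D) :
    Continuous fun y : ℝ ↦
      2 * (y : ℂ) * (∫ ξ in (-lam)..lam, D ξ * ((-(2 * π * ξ) * Real.sin (2 * π * ξ * y) : ℝ) : ℂ))
        - ((lam : ℂ) ^ 2 - (y : ℂ) ^ 2) * (∫ ξ in (-lam)..lam,
            (D ξ * ((-(2 * π * ξ) : ℝ) : ℂ)) * (((2 * π * ξ) * Real.cos (2 * π * ξ * y) : ℝ) : ℂ))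
        + (2 * π * lam * (y : ℂ)) ^ 2 * (∫ ξ in (-lam)..lam, D ξ * (Real.cos (2 * π * ξ * y) : ℂ)) :=
  (((by fun_prop : Continuous fun y : ℝ ↦ 2 * (y : ℂ)).mul (continuous_R1 hlam hD)).sub
    ((by fun_prop : Continuous fun y : ℝ ↦ (lam : ℂ) ^ 2 - (y : ℂ) ^ 2).mul (continuous_R2 hlam hD))).add
    ((by fun_prop : Continuous fun y : ℝ ↦ (2 * π * lam * (y : ℂ)) ^ 2).mul (continuous_R0 hlam hD))

/-- `𝐖(R₀D)` is even in `y`. [folklore] -/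
private theorem WR_neg (D : ℝ → ℂ) (y : ℝ) :
    2 * ((-y : ℝ) : ℂ) * (∫ ξ in (-lam)..lam, D ξ * ((-(2 * π * ξ) * Real.sin (2 * π * ξ * (-y)) : ℝ) : ℂ))
        - ((lam : ℂ) ^ 2 - ((-y : ℝ) : ℂ) ^ 2) * (∫ ξ in (-lam)..lam,
            (D ξ * ((-(2 * π * ξ) : ℝ) : ℂ)) * (((2 * π * ξ) * Real.cos (2 * π * ξ * (-y)) : ℝ) : ℂ))
        + (2 * π * lam * ((-y : ℝ) : ℂ)) ^ 2 * (∫ ξ in (-lam)..lam, D ξ * (Real.cos (2 * π * ξ * (-y)) : ℂ))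
      = 2 * (y : ℂ) * (∫ ξ in (-lam)..lam, D ξ * ((-(2 * π * ξ) * Real.sin (2 * π * ξ * y) : ℝ) : ℂ))
        - ((lam : ℂ) ^ 2 - (y : ℂ) ^ 2) * (∫ ξ in (-lam)..lam,
            (D ξ * ((-(2 * π * ξ) : ℝ) : ℂ)) * (((2 * π * ξ) * Real.cos (2 * π * ξ * y) : ℝ) : ℂ))
        + (2 * π * lam * (y : ℂ)) ^ 2 * (∫ ξ in (-lam)..lam, D ξ * (Real.cos (2 * π * ξ * y) : ℂ)) := by
  have h0 : (∫ ξ in (-lam)..lam, D ξ * (Real.cos (2 * π * ξ * (-y)) : ℂ))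
      = ∫ ξ in (-lam)..lam, D ξ * (Real.cos (2 * π * ξ * y) : ℂ) := by
    refine intervalIntegral.integral_congr fun ξ _ ↦ ?_
    simp only [mul_neg, Real.cos_neg]
  have h1 : (∫ ξ in (-lam)..lam, D ξ * ((-(2 * π * ξ) * Real.sin (2 * π * ξ * (-y)) : ℝ) : ℂ))
      = -∫ ξ in (-lam)..lam, D ξ * ((-(2 * π * ξ) * Real.sin (2 * π * ξ * y) : ℝ) : ℂ) := by
    rw [← intervalIntegral.integral_neg]
    refine intervalIntegral.integral_congr fun ξ _ ↦ ?_
    simp only [mul_neg, Real.sin_neg]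
    push_cast; ring
  have h2 : (∫ ξ in (-lam)..lam, (D ξ * ((-(2 * π * ξ) : ℝ) : ℂ)) * (((2 * π * ξ) * Real.cos (2 * π * ξ * (-y)) : ℝ) : ℂ))
      = ∫ ξ in (-lam)..lam, (D ξ * ((-(2 * π * ξ) : ℝ) : ℂ)) * (((2 * π * ξ) * Real.cos (2 * π * ξ * y) : ℝ) : ℂ) := by
    refine intervalIntegral.integral_congr fun ξ _ ↦ ?_
    simp only [mul_neg, Real.cos_neg]
  rw [h0, h1, h2]
  push_cast; ring

/-- **`𝐖` preserves the eigen-relation of the iterated cosine transform.**  If `D` is continuous and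
`C(R₀D) = ν D` (`C` the finite cosine transform in `x`, `R₀` the one in `ξ`), then
`C(𝐖 R₀D)` has cosine transform `ν 𝐖R₀D`: `∫_{−λ}^{λ} (C 𝐖R₀D)(ξ) cos(2πξy) dξ = ν (𝐖R₀D)(y)` — the
commutation `[𝐖, C∘C] = 0` in the form used for the sinc operator.
[cite: SlepianPollak1961, §III; ConnesConsani2021, §4 p. 16 eq. (prolateeq)] -/
theorem integral_cosTransform_WR_mul_cos (hlam : 0 < lam) (hD : Continuous D) {ν : ℂ} (hν : ν ≠ 0)
    (hCD : ∀ ξ : ℝ, ∫ x in (-lam)..lam,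
        (∫ η in (-lam)..lam, D η * (Real.cos (2 * π * η * x) : ℂ)) * (Real.cos (2 * π * x * ξ) : ℂ)
          = ν * D ξ) (y : ℝ) :
    ∫ ξ in (-lam)..lam,
        (∫ x in (-lam)..lam,
          (2 * (x : ℂ) * (∫ η in (-lam)..lam, D η * ((-(2 * π * η) * Real.sin (2 * π * η * x) : ℝ) : ℂ))
            - ((lam : ℂ) ^ 2 - (x : ℂ) ^ 2) * (∫ η in (-lam)..lam,
                (D η * ((-(2 * π * η) : ℝ) : ℂ)) * (((2 * π * η) * Real.cos (2 * π * η * x) : ℝ) : ℂ))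
            + (2 * π * lam * (x : ℂ)) ^ 2 * (∫ η in (-lam)..lam, D η * (Real.cos (2 * π * η * x) : ℂ)))
          * (Real.cos (2 * π * x * ξ) : ℂ)) * (Real.cos (2 * π * ξ * y) : ℂ)
      = ν * (2 * (y : ℂ) * (∫ η in (-lam)..lam, D η * ((-(2 * π * η) * Real.sin (2 * π * η * y) : ℝ) : ℂ))
            - ((lam : ℂ) ^ 2 - (y : ℂ) ^ 2) * (∫ η in (-lam)..lam,
                (D η * ((-(2 * π * η) : ℝ) : ℂ)) * (((2 * π * η) * Real.cos (2 * π * η * y) : ℝ) : ℂ))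
            + (2 * π * lam * (y : ℂ)) ^ 2 * (∫ η in (-lam)..lam, D η * (Real.cos (2 * π * η * y) : ℂ))) := by
  -- the `x`-transforms of `R₀D`
  set Q₀ : ℝ → ℂ := fun ξ ↦ ∫ x in (-lam)..lam,
    (∫ η in (-lam)..lam, D η * (Real.cos (2 * π * η * x) : ℂ)) * (Real.cos (2 * π * x * ξ) : ℂ) with hQ₀
  set Q₁ : ℝ → ℂ := fun ξ ↦ ∫ x in (-lam)..lam,
    (∫ η in (-lam)..lam, D η * (Real.cos (2 * π * η * x) : ℂ))
      * ((-(2 * π * x) * Real.sin (2 * π * x * ξ) : ℝ) : ℂ) with hQ₁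
  set Q₂ : ℝ → ℂ := fun ξ ↦ ∫ x in (-lam)..lam,
    ((∫ η in (-lam)..lam, D η * (Real.cos (2 * π * η * x) : ℂ)) * ((-(2 * π * x) : ℝ) : ℂ))
      * (((2 * π * x) * Real.cos (2 * π * x * ξ) : ℝ) : ℂ) with hQ₂
  have hR0c := continuous_R0 hlam hD
  -- commutation in `x`: `C(𝐖R₀D)(ξ) = 2ξ Q₁ − (λ²−ξ²) Q₂ + (2πλξ)² Q₀`
  have hcomm : ∀ ξ : ℝ, (∫ x in (-lam)..lam,
      (2 * (x : ℂ) * (∫ η in (-lam)..lam, D η * ((-(2 * π * η) * Real.sin (2 * π * η * x) : ℝ) : ℂ))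
        - ((lam : ℂ) ^ 2 - (x : ℂ) ^ 2) * (∫ η in (-lam)..lam,
            (D η * ((-(2 * π * η) : ℝ) : ℂ)) * (((2 * π * η) * Real.cos (2 * π * η * x) : ℝ) : ℂ))
        + (2 * π * lam * (x : ℂ)) ^ 2 * (∫ η in (-lam)..lam, D η * (Real.cos (2 * π * η * x) : ℂ)))
        * (Real.cos (2 * π * x * ξ) : ℂ))
      = 2 * (ξ : ℂ) * Q₁ ξ - ((lam : ℂ) ^ 2 - (ξ : ℂ) ^ 2) * Q₂ ξ + (2 * π * lam * (ξ : ℂ)) ^ 2 * Q₀ ξ := fun ξ ↦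
    (prolateW_cosTransform_comm hlam (fun x _ ↦ hasDerivAt_R0 hlam hD x)
      (fun x _ ↦ hasDerivAt_R1 hlam hD x) (continuous_R2 hlam hD).continuousOn ξ).symm
  -- `Q₀ = ν D`, and `Q₁, Q₂` are the derivatives of `Q₀`
  have hQ₀D : ∀ ξ, Q₀ ξ = ν * D ξ := hCD
  have hQ₀d : ∀ ξ, HasDerivAt Q₀ (Q₁ ξ) ξ := fun ξ ↦
    hasDerivAt_integral_mul_cosC hlam hR0c.continuousOn ξ
  have hQ₁d : ∀ ξ, HasDerivAt Q₁ (Q₂ ξ) ξ := fun ξ ↦ by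
    have hR0' : Continuous fun x : ℝ ↦
        (∫ η in (-lam)..lam, D η * (Real.cos (2 * π * η * x) : ℂ)) * ((-(2 * π * x) : ℝ) : ℂ) := by fun_prop
    have h := hasDerivAt_integral_mul_sinC hlam hR0'.continuousOn ξ
    have e : Q₁ = fun ξ : ℝ ↦ ∫ x in (-lam)..lam,
        ((∫ η in (-lam)..lam, D η * (Real.cos (2 * π * η * x) : ℂ)) * ((-(2 * π * x) : ℝ) : ℂ))
          * (Real.sin (2 * π * x * ξ) : ℂ) := by
      funext ξ; rw [hQ₁]
      refine intervalIntegral.integral_congr fun x _ ↦ ?_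
      push_cast; ring
    rw [e]; exact h
  have hQ₂c : Continuous Q₂ := by
    have hR0'' : Continuous fun x : ℝ ↦
        (∫ η in (-lam)..lam, D η * (Real.cos (2 * π * η * x) : ℂ)) * ((-(2 * π * x) : ℝ) : ℂ)
          * (((2 * π * x) : ℝ) : ℂ) := by fun_prop
    have e : Q₂ = fun ξ : ℝ ↦ ∫ x in (-lam)..lam,
        ((∫ η in (-lam)..lam, D η * (Real.cos (2 * π * η * x) : ℂ)) * ((-(2 * π * x) : ℝ) : ℂ)
          * (((2 * π * x) : ℝ) : ℂ)) * (Real.cos (2 * π * x * ξ) : ℂ) := by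
      funext ξ; rw [hQ₂]
      refine intervalIntegral.integral_congr fun x _ ↦ ?_
      push_cast; ring
    rw [e]
    exact continuous_iff_continuousAt.2 fun ξ ↦
      (hasDerivAt_integral_mul_cosC hlam hR0''.continuousOn ξ).continuousAt
  -- derivative data for `D`: `D₁ = ν⁻¹ Q₁`, `D₂ = ν⁻¹ Q₂`
  have hDd : ∀ ξ, HasDerivAt D (ν⁻¹ * Q₁ ξ) ξ := fun ξ ↦ by
    have e : D = fun ξ ↦ ν⁻¹ * Q₀ ξ := by funext ξ; rw [hQ₀D]; field_simp
    rw [e]; exact (hQ₀d ξ).const_mul ν⁻¹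
  have hD₁d : ∀ ξ, HasDerivAt (fun ξ ↦ ν⁻¹ * Q₁ ξ) (ν⁻¹ * Q₂ ξ) ξ := fun ξ ↦ (hQ₁d ξ).const_mul ν⁻¹
  have hD₂c : ContinuousOn (fun ξ ↦ ν⁻¹ * Q₂ ξ) (Icc (-lam) lam) := (continuous_const.mul hQ₂c).continuousOn
  -- the cosine kernel in `ξ` with parameter `y`
  have hv : ∀ ξ ∈ Icc (-lam) lam, HasDerivAt (fun η : ℝ ↦ (Real.cos (2 * π * η * y) : ℂ))
      (((-(2 * π * y) * Real.sin (2 * π * ξ * y) : ℝ) : ℂ)) ξ := by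
    intro ξ _
    have h := ((((hasDerivAt_id ξ).const_mul (2 * π)).mul_const y).cos).ofReal_comp
    refine h.congr_deriv ?_
    simp only [id]; push_cast; ring
  have hv₁ : ∀ ξ ∈ Icc (-lam) lam, HasDerivAt (fun η : ℝ ↦ ((-(2 * π * y) * Real.sin (2 * π * η * y) : ℝ) : ℂ))
      (((-(2 * π * y) ^ 2 * Real.cos (2 * π * ξ * y) : ℝ) : ℂ)) ξ := by
    intro ξ _
    have h := (((((hasDerivAt_id ξ).const_mul (2 * π)).mul_const y).sin).const_mul (-(2 * π * y))).ofReal_comp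
    refine h.congr_deriv ?_
    simp only [id]; push_cast; ring
  have hv₂c : ContinuousOn (fun ξ : ℝ ↦ ((-(2 * π * y) ^ 2 * Real.cos (2 * π * ξ * y) : ℝ) : ℂ))
      (Icc (-lam) lam) := by fun_prop
  have hG := integral_prolateW_mul_comm hlam (fun ξ _ ↦ hDd ξ) (fun ξ _ ↦ hD₁d ξ) hv hv₁ hD₂c hv₂c
  -- assemble
  have hle : -lam ≤ lam := by linarith
  calc ∫ ξ in (-lam)..lam, (∫ x in (-lam)..lam,
          (2 * (x : ℂ) * (∫ η in (-lam)..lam, D η * ((-(2 * π * η) * Real.sin (2 * π * η * x) : ℝ) : ℂ))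
            - ((lam : ℂ) ^ 2 - (x : ℂ) ^ 2) * (∫ η in (-lam)..lam,
                (D η * ((-(2 * π * η) : ℝ) : ℂ)) * (((2 * π * η) * Real.cos (2 * π * η * x) : ℝ) : ℂ))
            + (2 * π * lam * (x : ℂ)) ^ 2 * (∫ η in (-lam)..lam, D η * (Real.cos (2 * π * η * x) : ℂ)))
          * (Real.cos (2 * π * x * ξ) : ℂ)) * (Real.cos (2 * π * ξ * y) : ℂ)
      = ∫ ξ in (-lam)..lam, ν * ((2 * ξ * (ν⁻¹ * Q₁ ξ) - ((lam : ℂ) ^ 2 - (ξ : ℂ) ^ 2) * (ν⁻¹ * Q₂ ξ)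
            + (2 * π * lam * ξ) ^ 2 * D ξ) * (Real.cos (2 * π * ξ * y) : ℂ)) := by
        refine intervalIntegral.integral_congr fun ξ _ ↦ ?_
        show _ = ν * _
        rw [hcomm ξ, hQ₀D ξ]
        field_simp
    _ = ν * ∫ ξ in (-lam)..lam, D ξ * (2 * ξ * (((-(2 * π * y) * Real.sin (2 * π * ξ * y) : ℝ) : ℂ))
            - ((lam : ℂ) ^ 2 - (ξ : ℂ) ^ 2) * (((-(2 * π * y) ^ 2 * Real.cos (2 * π * ξ * y) : ℝ) : ℂ))
            + (2 * π * lam * ξ) ^ 2 * (Real.cos (2 * π * ξ * y) : ℂ)) := by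
        rw [intervalIntegral.integral_const_mul, hG]
    _ = _ := by
        have hIa : IntervalIntegrable
            (fun η : ℝ ↦ D η * ((-(2 * π * η) * Real.sin (2 * π * η * y) : ℝ) : ℂ)) volume (-lam) lam :=
          ((hD.mul (by fun_prop)).continuousOn).intervalIntegrable_of_Icc hle
        have hIb : IntervalIntegrable (fun η : ℝ ↦
            (D η * ((-(2 * π * η) : ℝ) : ℂ)) * (((2 * π * η) * Real.cos (2 * π * η * y) : ℝ) : ℂ)) volume (-lam) lam :=
          (((hD.mul (by fun_prop)).mul (by fun_prop)).continuousOn).intervalIntegrable_of_Icc hle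
        have hIc : IntervalIntegrable (fun η : ℝ ↦ D η * (Real.cos (2 * π * η * y) : ℂ)) volume (-lam) lam :=
          ((hD.mul (by fun_prop)).continuousOn).intervalIntegrable_of_Icc hle
        congr 1
        rw [← intervalIntegral.integral_const_mul, ← intervalIntegral.integral_const_mul,
          ← intervalIntegral.integral_const_mul, ← intervalIntegral.integral_sub (hIa.const_mul _) (hIb.const_mul _),
          ← intervalIntegral.integral_add ((hIa.const_mul _).sub (hIb.const_mul _)) (hIc.const_mul _)]
        refine intervalIntegral.integral_congr fun ξ _ ↦ ?_
        push_cast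
        ring

/-- Complex conjugation of an interval integral over `[−λ, λ]`. [folklore] -/
private theorem conj_intervalIntegral (hlam : 0 < lam) (f : ℝ → ℂ) :
    conj (∫ ξ in (-lam)..lam, f ξ) = ∫ ξ in (-lam)..lam, conj (f ξ) := by
  have hle : -lam ≤ lam := by linarith
  rw [intervalIntegral.integral_of_le hle,
    intervalIntegral.integral_of_le hle, ← integral_conj]

/-- **Symmetry of `𝐖` on band-limited functions**: `∫_{−λ}^{λ} conj(𝐖R₀D) · R₀D' = ∫_{−λ}^{λ} conj(R₀D) · 𝐖R₀D'`
(Green's identity; `𝐖` has real coefficients). [cite: ConnesConsani2021, §4 p. 16 eq. (WLambdaq); SlepianPollak1961, §III] -/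
theorem integral_conj_WR_mul_R0 (hlam : 0 < lam) {D D' : ℝ → ℂ} (hD : Continuous D)
    (hD' : Continuous D') :
    ∫ x in (-lam)..lam, conj
        (2 * (x : ℂ) * (∫ ξ in (-lam)..lam, D ξ * ((-(2 * π * ξ) * Real.sin (2 * π * ξ * x) : ℝ) : ℂ))
          - ((lam : ℂ) ^ 2 - (x : ℂ) ^ 2) * (∫ ξ in (-lam)..lam,
              (D ξ * ((-(2 * π * ξ) : ℝ) : ℂ)) * (((2 * π * ξ) * Real.cos (2 * π * ξ * x) : ℝ) : ℂ))
          + (2 * π * lam * (x : ℂ)) ^ 2 * (∫ ξ in (-lam)..lam, D ξ * (Real.cos (2 * π * ξ * x) : ℂ)))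
        * (∫ ξ in (-lam)..lam, D' ξ * (Real.cos (2 * π * ξ * x) : ℂ))
      = ∫ x in (-lam)..lam, conj (∫ ξ in (-lam)..lam, D ξ * (Real.cos (2 * π * ξ * x) : ℂ))
        * (2 * (x : ℂ) * (∫ ξ in (-lam)..lam, D' ξ * ((-(2 * π * ξ) * Real.sin (2 * π * ξ * x) : ℝ) : ℂ))
          - ((lam : ℂ) ^ 2 - (x : ℂ) ^ 2) * (∫ ξ in (-lam)..lam,
              (D' ξ * ((-(2 * π * ξ) : ℝ) : ℂ)) * (((2 * π * ξ) * Real.cos (2 * π * ξ * x) : ℝ) : ℂ))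
          + (2 * π * lam * (x : ℂ)) ^ 2 * (∫ ξ in (-lam)..lam, D' ξ * (Real.cos (2 * π * ξ * x) : ℂ))) := by
  set E : ℝ → ℂ := fun ξ ↦ conj (D ξ) with hE
  have hE' : Continuous E := Complex.continuous_conj.comp hD
  -- conjugates of `R₀D, R₁D, R₂D` are `R₀E, R₁E, R₂E`
  have c0 : ∀ x : ℝ, conj (∫ ξ in (-lam)..lam, D ξ * (Real.cos (2 * π * ξ * x) : ℂ))
      = ∫ ξ in (-lam)..lam, E ξ * (Real.cos (2 * π * ξ * x) : ℂ) := fun x ↦ by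
    rw [conj_intervalIntegral hlam]
    refine intervalIntegral.integral_congr fun ξ _ ↦ ?_
    simp only [hE, map_mul, Complex.conj_ofReal]
  have c1 : ∀ x : ℝ, conj (∫ ξ in (-lam)..lam, D ξ * ((-(2 * π * ξ) * Real.sin (2 * π * ξ * x) : ℝ) : ℂ))
      = ∫ ξ in (-lam)..lam, E ξ * ((-(2 * π * ξ) * Real.sin (2 * π * ξ * x) : ℝ) : ℂ) := fun x ↦ by
    rw [conj_intervalIntegral hlam]
    refine intervalIntegral.integral_congr fun ξ _ ↦ ?_
    simp only [hE, map_mul, Complex.conj_ofReal]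
  have c2 : ∀ x : ℝ, conj (∫ ξ in (-lam)..lam,
        (D ξ * ((-(2 * π * ξ) : ℝ) : ℂ)) * (((2 * π * ξ) * Real.cos (2 * π * ξ * x) : ℝ) : ℂ))
      = ∫ ξ in (-lam)..lam, (E ξ * ((-(2 * π * ξ) : ℝ) : ℂ)) * (((2 * π * ξ) * Real.cos (2 * π * ξ * x) : ℝ) : ℂ) :=
    fun x ↦ by
    rw [conj_intervalIntegral hlam]
    refine intervalIntegral.integral_congr fun ξ _ ↦ ?_
    simp only [hE, map_mul, Complex.conj_ofReal]
  have hconjW : ∀ x : ℝ, conj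
        (2 * (x : ℂ) * (∫ ξ in (-lam)..lam, D ξ * ((-(2 * π * ξ) * Real.sin (2 * π * ξ * x) : ℝ) : ℂ))
          - ((lam : ℂ) ^ 2 - (x : ℂ) ^ 2) * (∫ ξ in (-lam)..lam,
              (D ξ * ((-(2 * π * ξ) : ℝ) : ℂ)) * (((2 * π * ξ) * Real.cos (2 * π * ξ * x) : ℝ) : ℂ))
          + (2 * π * lam * (x : ℂ)) ^ 2 * (∫ ξ in (-lam)..lam, D ξ * (Real.cos (2 * π * ξ * x) : ℂ)))
      = 2 * (x : ℂ) * (∫ ξ in (-lam)..lam, E ξ * ((-(2 * π * ξ) * Real.sin (2 * π * ξ * x) : ℝ) : ℂ))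
          - ((lam : ℂ) ^ 2 - (x : ℂ) ^ 2) * (∫ ξ in (-lam)..lam,
              (E ξ * ((-(2 * π * ξ) : ℝ) : ℂ)) * (((2 * π * ξ) * Real.cos (2 * π * ξ * x) : ℝ) : ℂ))
          + (2 * π * lam * (x : ℂ)) ^ 2 * (∫ ξ in (-lam)..lam, E ξ * (Real.cos (2 * π * ξ * x) : ℂ)) := fun x ↦ by
    simp only [map_add, map_sub, map_mul, map_pow, Complex.conj_ofReal, c0, c1, c2, map_ofNat]
  simp_rw [hconjW, c0]
  exact integral_prolateW_mul_comm hlam (fun x _ ↦ hasDerivAt_R0 hlam hE' x)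
    (fun x _ ↦ hasDerivAt_R1 hlam hE' x) (fun x _ ↦ hasDerivAt_R0 hlam hD' x)
    (fun x _ ↦ hasDerivAt_R1 hlam hD' x) (continuous_R2 hlam hE').continuousOn
    (continuous_R2 hlam hD').continuousOn

/-- The data form `2y R₁D − (λ²−y²) R₂D + (2πλy)² R₀D` of `𝐖R₀D` as ONE integral against the kernel
`M(ξ,y) = −4πξy sin(2πξy) + ((λ²−y²)(2πξ)² + (2πλy)²) cos(2πξy)`. [folklore] -/
private theorem WR_eq_integral_kernel (hlam : 0 < lam) (hD : Continuous D) (y : ℝ) :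
    2 * (y : ℂ) * (∫ ξ in (-lam)..lam, D ξ * ((-(2 * π * ξ) * Real.sin (2 * π * ξ * y) : ℝ) : ℂ))
        - ((lam : ℂ) ^ 2 - (y : ℂ) ^ 2) * (∫ ξ in (-lam)..lam,
            (D ξ * ((-(2 * π * ξ) : ℝ) : ℂ)) * (((2 * π * ξ) * Real.cos (2 * π * ξ * y) : ℝ) : ℂ))
        + (2 * π * lam * (y : ℂ)) ^ 2 * (∫ ξ in (-lam)..lam, D ξ * (Real.cos (2 * π * ξ * y) : ℂ))
      = ∫ ξ in (-lam)..lam, D ξ * ((-(4 * π * ξ * y) * Real.sin (2 * π * ξ * y)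
          + ((lam ^ 2 - y ^ 2) * (2 * π * ξ) ^ 2 + (2 * π * lam * y) ^ 2) * Real.cos (2 * π * ξ * y) : ℝ) : ℂ) := by
  have hle : -lam ≤ lam := by linarith
  have hIa : IntervalIntegrable
      (fun ξ : ℝ ↦ D ξ * ((-(2 * π * ξ) * Real.sin (2 * π * ξ * y) : ℝ) : ℂ)) volume (-lam) lam :=
    ((hD.mul (by fun_prop)).continuousOn).intervalIntegrable_of_Icc hle
  have hIb : IntervalIntegrable (fun ξ : ℝ ↦
      (D ξ * ((-(2 * π * ξ) : ℝ) : ℂ)) * (((2 * π * ξ) * Real.cos (2 * π * ξ * y) : ℝ) : ℂ)) volume (-lam) lam :=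
    (((hD.mul (by fun_prop)).mul (by fun_prop)).continuousOn).intervalIntegrable_of_Icc hle
  have hIc : IntervalIntegrable (fun ξ : ℝ ↦ D ξ * (Real.cos (2 * π * ξ * y) : ℂ)) volume (-lam) lam :=
    ((hD.mul (by fun_prop)).continuousOn).intervalIntegrable_of_Icc hle
  rw [← intervalIntegral.integral_const_mul, ← intervalIntegral.integral_const_mul,
    ← intervalIntegral.integral_const_mul, ← intervalIntegral.integral_sub (hIa.const_mul _) (hIb.const_mul _),
    ← intervalIntegral.integral_add ((hIa.const_mul _).sub (hIb.const_mul _)) (hIc.const_mul _)]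
  refine intervalIntegral.integral_congr fun ξ _ ↦ ?_
  push_cast
  ring

end BandLimited

/-! ## Part C: identification of even principal solutions with the tree's prolate functions (real) -/

/-! ### Step C1: a solution which is `C¹` up to the singular end point `x = λ` is a multiple of the
Frobenius solution -/

/-- **Principal solutions at the singular end point.**  A solution `g` of the prolate equation
(`λ = 1`, parameter `χ`) on `(−λ, λ)` whose first derivative extends continuously to `x = λ` (here:
`g ∈ C¹(ℝ)`) is a multiple of the Frobenius solution `u_χ` on `(−λ, λ)`: the Wronskian
`(1 − x²)(g′u − g u′)` is constant on `(−λ,λ)` and tends to `0` at `1`, so `g/u` is constant near `1`,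
and Cauchy uniqueness at a regular point propagates. [cite: CoddingtonLevinson1955, Ch. 4 §8 & Ch. 8 §1; SlepianPollak1961, §III] -/
theorem exists_eq_mul_frobSol (hlam : 0 < lam) {g g₁ g₂ : ℝ → ℝ} {χ : ℝ}
    (hg : ∀ x, HasDerivAt g (g₁ x) x) (hg₁ : ∀ x, HasDerivAt g₁ (g₂ x) x)
    (hsol : IsProlateODESol lam χ (Ioo (-lam) lam) g g₁ g₂) :
    ∃ a : ℝ, ∀ x ∈ Ioo (-lam) lam, g x = a * frobSol lam χ x := by
  have h13 : Ioo (-lam) lam ⊆ Ioo (-lam) (3 * lam) := Ioo_subset_Ioo_three hlam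
  have hu := isProlateODESol_frobSol hlam χ
  have hmem3 : ∀ x ∈ Ioo (-lam) lam, |lam - x| < 2 * lam := fun x hx ↦ mem_Ioo_three_iff.mp (h13 hx)
  have h1mem : |lam - lam| < 2 * lam := by rw [sub_self, abs_zero]; linarith
  -- the Wronskian
  set w : ℝ → ℝ := fun x ↦ (lam ^ 2 - x ^ 2) * (g₁ x * frobSol lam χ x - g x * frobSol₁ lam χ x) with hw
  have hwd : ∀ x ∈ Ioo (-lam) lam, HasDerivAt w 0 x := by
    intro x hx
    have hU := hasDerivAt_frobSol hlam χ (hmem3 x hx)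
    have hU1 := hasDerivAt_frobSol₁ hlam χ (hmem3 x hx)
    have hp : HasDerivAt (fun y : ℝ ↦ lam ^ 2 - y ^ 2) (-(2 * x)) x := by
      simpa using (hasDerivAt_pow 2 x).const_sub (lam ^ 2)
    have h := hp.mul (((hg₁ x).mul hU).sub ((hg x).mul hU1))
    refine h.congr_deriv ?_
    have e1 := hsol.ode x hx
    have e2 := hu.ode x (h13 hx)
    simp only [Pi.mul_apply, Pi.sub_apply]
    linear_combination frobSol lam χ x * e1 - g x * e2
  obtain ⟨c, hc⟩ : ∃ c, ∀ x ∈ Ioo (-lam) lam, w x = c :=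
    isOpen_Ioo.exists_is_const_of_deriv_eq_zero isPreconnected_Ioo
      (fun x hx ↦ (hwd x hx).differentiableAt.differentiableWithinAt)
      (fun x hx ↦ (hwd x hx).deriv)
  -- `w → w(λ) = 0` from inside, so `c = 0`
  have hwc : ContinuousAt w lam := by
    have hU := (hasDerivAt_frobSol hlam χ h1mem).continuousAt
    have hU1 := (hasDerivAt_frobSol₁ hlam χ h1mem).continuousAt
    exact ((continuous_const.sub (continuous_pow 2)).continuousAt).mul
      ((((hg₁ lam).continuousAt).mul hU).sub (((hg lam).continuousAt).mul hU1))
  have hw1 : w lam = 0 := by simp [hw]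
  have hc0 : c = 0 := by
    haveI : (𝓝[Ioo (-lam) lam] lam).NeBot := right_nhdsWithin_Ioo_neBot (by linarith)
    have T1 : Tendsto w (𝓝[Ioo (-lam) lam] lam) (𝓝 (w lam)) := hwc.continuousWithinAt.tendsto
    have T2 : Tendsto w (𝓝[Ioo (-lam) lam] lam) (𝓝 c) :=
      tendsto_const_nhds.congr' (by
        filter_upwards [self_mem_nhdsWithin] with x hx using (hc x hx).symm)
    have := tendsto_nhds_unique T2 T1
    rw [this, hw1]
  -- near `λ` the Frobenius solution does not vanish: `g/u` is constant there
  have hupos : ∀ᶠ x in 𝓝 lam, 0 < frobSol lam χ x := by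
    have hU := (hasDerivAt_frobSol hlam χ h1mem).continuousAt
    have : (0 : ℝ) < frobSol lam χ lam := by rw [frobSol_self]; exact one_pos
    exact hU.eventually (Ioi_mem_nhds this)
  obtain ⟨δ, hδ, hδu⟩ : ∃ δ > 0, ∀ x, dist x lam < δ → 0 < frobSol lam χ x :=
    Metric.eventually_nhds_iff.1 hupos
  set δ' : ℝ := min δ lam with hδ'
  have hδ'pos : 0 < δ' := lt_min hδ hlam
  set J : Set ℝ := Ioo (lam - δ') lam with hJ
  have hJsub : J ⊆ Ioo (-lam) lam := fun x hx ↦ ⟨by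
    have : δ' ≤ lam := min_le_right _ _; linarith [hx.1], hx.2⟩
  have hJu : ∀ x ∈ J, 0 < frobSol lam χ x := fun x hx ↦ hδu x (by
    rw [Real.dist_eq, abs_lt]; constructor <;>
      linarith [hx.1, hx.2, min_le_left δ lam])
  -- `(g/u)' = 0` on `J`
  have hquot : ∀ x ∈ J, HasDerivAt (fun y ↦ g y / frobSol lam χ y) 0 x := by
    intro x hx
    have hx' := hJsub hx
    have hU := hasDerivAt_frobSol hlam χ (hmem3 x hx')
    have h := (hg x).div hU (hJu x hx).ne'
    refine h.congr_deriv ?_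
    have hw0 : w x = 0 := by rw [hc x hx', hc0]
    have hx1 : lam ^ 2 - x ^ 2 ≠ 0 := by
      have : |x| < lam := abs_lt.2 ⟨hx'.1, hx'.2⟩
      nlinarith [abs_nonneg x, sq_abs x]
    have : g₁ x * frobSol lam χ x - g x * frobSol₁ lam χ x = 0 := by
      have := hw0; simp only [hw] at this
      rcases mul_eq_zero.1 this with h | h
      · exact absurd h hx1
      · exact h
    rw [this, zero_div]
  obtain ⟨a, ha⟩ : ∃ a, ∀ x ∈ J, g x / frobSol lam χ x = a :=
    isOpen_Ioo.exists_is_const_of_deriv_eq_zero isPreconnected_Ioo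
      (fun x hx ↦ (hquot x hx).differentiableAt.differentiableWithinAt)
      (fun x hx ↦ (hquot x hx).deriv)
  have hgJ : ∀ x ∈ J, g x = a * frobSol lam χ x := fun x hx ↦ by
    have := ha x hx
    field_simp [(hJu x hx).ne'] at this
    linarith [this]
  -- `h = g − a u` vanishes on `J`, hence has a double zero, hence vanishes on `(−λ, λ)`
  have hh : IsProlateODESol lam χ (Ioo (-lam) lam) (fun x ↦ g x + -a * frobSol lam χ x)
      (fun x ↦ g₁ x + -a * frobSol₁ lam χ x) (fun x ↦ g₂ x + -a * frobSol₂ lam χ x) :=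
    hsol.add ((hu.mono h13).const_mul (-a))
  have hx₀J : (lam - δ' / 2 : ℝ) ∈ J := ⟨by linarith, by linarith⟩
  have hx₀ : (lam - δ' / 2 : ℝ) ∈ Ioo (-lam) lam := hJsub hx₀J
  have hzeroJ : ∀ x ∈ J, g x + -a * frobSol lam χ x = 0 := fun x hx ↦ by rw [hgJ x hx]; ring
  have h0 : g (lam - δ' / 2) + -a * frobSol lam χ (lam - δ' / 2) = 0 := hzeroJ _ hx₀J
  have h1 : g₁ (lam - δ' / 2) + -a * frobSol₁ lam χ (lam - δ' / 2) = 0 := by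
    -- the derivative of a function vanishing on the open set `J` vanishes
    have hd := hh.hasDerivAt _ hx₀
    have hev : (fun x ↦ g x + -a * frobSol lam χ x) =ᶠ[𝓝 (lam - δ' / 2 : ℝ)] fun _ ↦ (0 : ℝ) := by
      filter_upwards [isOpen_Ioo.mem_nhds hx₀J] with x hx using hzeroJ x hx
    exact hd.unique ((hasDerivAt_const (lam - δ' / 2 : ℝ) (0 : ℝ)).congr_of_eventuallyEq hev)
  have hz := hh.eq_zero_of_double_zero hlam Subset.rfl hx₀ h0 h1
  exact ⟨a, fun x hx ↦ by linarith [hz x hx]⟩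

/-! ### Step C2: an even `C²` solution on `(−λ,λ)`, `C¹` up to the end points, is a multiple of a tree
prolate function -/

/-- A function with continuous second derivative (given through derivative data) is `C²`. [folklore] -/
private theorem contDiff_two_of_hasDerivAt {g g₁ g₂ : ℝ → ℝ} (hg : ∀ x, HasDerivAt g (g₁ x) x)
    (hg₁ : ∀ x, HasDerivAt g₁ (g₂ x) x) (hg₂ : Continuous g₂) : ContDiff ℝ 2 g := by
  have hd : deriv g = g₁ := funext fun x ↦ (hg x).deriv
  have hd₁ : deriv g₁ = g₂ := funext fun x ↦ (hg₁ x).deriv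
  rw [show (2 : WithTop ℕ∞) = 1 + 1 from rfl, contDiff_succ_iff_deriv]
  refine ⟨fun x ↦ (hg x).differentiableAt, by simp, ?_⟩
  rw [hd, contDiff_one_iff_deriv]
  exact ⟨fun x ↦ (hg₁ x).differentiableAt, by rw [hd₁]; exact hg₂⟩

/-- **Identification with the prolate functions of band `λ`.**  An even solution `g ∈ C²(ℝ)` (derivative
data `g₁, g₂`, `g₂` continuous) of the prolate equation with parameter `χ` on `(−λ, λ)` is, on `[−λ, λ]`, a
real multiple of SOME even-indexed prolate function of band `λ` (a function `e` with
`IsProlateFunction λ (2k) e`): by `exists_eq_mul_frobSol` it is `a·u_χ` on `(−λ,λ)`; if `a ≠ 0`, evenness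
gives `u_χ′(0) = 0`, `u_χ` has finitely many (`k`) zeros in `(0,λ)`, and the normalised truncated function
satisfies the axioms `IsProlateFunction λ (2k)` (as in the tree's `exists_isProlateFunction_of_frobSol`); if
`a = 0` any prolate function (they exist: `existsUnique_isProlateFunction_holds`) with coefficient `0` does.
[cite: SlepianPollak1961, §III; ConnesConsaniMoscovici2025, §7 (7.9)–(7.12)] -/
theorem exists_eq_mul_prolate (hlam : 0 < lam) {g g₁ g₂ : ℝ → ℝ} {χ : ℝ}
    (hg : ∀ x, HasDerivAt g (g₁ x) x) (hg₁ : ∀ x, HasDerivAt g₁ (g₂ x) x) (hg₂ : Continuous g₂)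
    (hsol : IsProlateODESol lam χ (Ioo (-lam) lam) g g₁ g₂) (heven : ∀ x, g (-x) = g x) :
    ∃ (k : ℕ) (e : ℝ → ℝ) (c : ℝ), IsProlateFunction lam (2 * k) e ∧
      ∀ x ∈ Icc (-lam) lam, g x = c * e x := by
  have hgc : Continuous g := continuous_iff_continuousAt.2 fun x ↦ (hg x).continuousAt
  obtain ⟨a, ha⟩ := exists_eq_mul_frobSol hlam hg hg₁ hsol
  by_cases ha0 : a = 0
  · obtain ⟨e, he, -⟩ := existsUnique_isProlateFunction_holds lam hlam 0 ⟨0, rfl⟩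
    refine ⟨0, e, 0, (by rw [Nat.mul_zero]; exact he), fun x hx ↦ ?_⟩
    rw [zero_mul]
    have hx' : x ∈ closure (Ioo (-lam) lam) := by
      rw [closure_Ioo (neg_lt_self hlam).ne]; exact hx
    exact (isClosed_eq hgc continuous_const).closure_subset_iff.2
      (fun y hy ↦ by simp only [mem_setOf_eq]; rw [ha y hy, ha0, zero_mul]) hx'
  -- `a ≠ 0`: `g′(0) = 0` by evenness, hence `u_χ′(0) = 0`
  have h0mem : (0 : ℝ) ∈ Ioo (-lam) lam := ⟨by linarith, hlam⟩
  have h0mem3 : |lam - 0| < 2 * lam := by rw [sub_zero, abs_of_pos hlam]; linarith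
  have hg₁0 : g₁ 0 = 0 := by
    have h1 : HasDerivAt (fun x ↦ g (-x)) (g₁ (-0) * (-1)) 0 := (hg (-0)).comp 0 (hasDerivAt_neg' (0 : ℝ))
    have h2 : (fun x ↦ g (-x)) = g := funext heven
    rw [h2, neg_zero] at h1
    have := (hg 0).unique h1
    linarith
  have hB : frobSol₁ lam χ 0 = 0 := by
    have hev : g =ᶠ[𝓝 (0 : ℝ)] fun x ↦ a * frobSol lam χ x := by
      filter_upwards [isOpen_Ioo.mem_nhds h0mem] with x hx using ha x hx
    have h1 : HasDerivAt g (a * frobSol₁ lam χ 0) 0 :=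
      ((hasDerivAt_frobSol hlam χ h0mem3).const_mul a).congr_of_eventuallyEq hev
    have := (hg 0).unique h1
    rw [hg₁0] at this
    rcases mul_eq_zero.1 this.symm with h | h
    · exact absurd h ha0
    · exact h
  have hueven : ∀ x ∈ Ioo (-lam) lam, frobSol lam χ (-x) = frobSol lam χ x :=
    fun x hx ↦ frobSol_neg_eq hlam hB hx
  have hu0 : frobSol lam χ 0 ≠ 0 := fun h ↦ frobSol₁_ne_zero_of_zero hlam χ h0mem h hB
  have hga0 : g 0 ≠ 0 := by rw [ha 0 h0mem]; exact mul_ne_zero ha0 hu0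
  -- zeros of `u_χ` in `(0, λ)`
  set Z := {x | x ∈ Ioo (0 : ℝ) lam ∧ frobSol lam χ x = 0} with hZ
  have hZfin : Z.Finite := finite_zeros_frobSol hlam χ
  set k : ℕ := Z.ncard with hk
  -- normalisation
  set N : ℝ := ∫ x in (-lam)..lam, g x ^ 2 with hN
  have hNpos : 0 < N := by
    rw [hN]
    have h := intervalIntegral.integral_lt_integral_of_continuousOn_of_le_of_exists_lt
      (f := fun _ ↦ (0 : ℝ)) (g := fun x ↦ g x ^ 2) (by linarith : -lam < lam) continuousOn_const
      (hgc.pow 2).continuousOn (fun x _ ↦ sq_nonneg (g x)) ⟨0, ⟨by linarith, by linarith⟩, by positivity⟩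
    simpa using h
  set sgn : ℝ := if 0 < g 0 then 1 else -1 with hsgn
  have hsgn1 : sgn ^ 2 = 1 := by rw [hsgn]; split_ifs <;> norm_num
  have hsgnpos : 0 < sgn * g 0 := by
    rw [hsgn]; split_ifs with h
    · simpa using h
    · have : g 0 < 0 := lt_of_le_of_ne (not_lt.mp h) hga0
      linarith
  set C : ℝ := sgn / Real.sqrt N with hC
  have hsqrt : 0 < Real.sqrt N := Real.sqrt_pos.2 hNpos
  have hC2 : C ^ 2 * N = 1 := by
    rw [hC, div_pow, hsgn1, Real.sq_sqrt hNpos.le]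
    field_simp
  have hC0 : C ≠ 0 := by
    intro h; rw [h] at hC2; simp at hC2
  -- the normalised, truncated function
  set f : ℝ → ℝ := fun x ↦ if |x| ≤ lam then C * g x else 0 with hf
  have hfIcc : ∀ x ∈ Icc (-lam) lam, f x = C * g x := fun x hx ↦ by
    simp only [hf, if_pos (abs_le.2 ⟨hx.1, hx.2⟩)]
  have hfIoo : ∀ x ∈ Ioo (-lam) lam, f x = C * g x := fun x hx ↦ hfIcc x (Ioo_subset_Icc_self hx)
  have hfev : ∀ x ∈ Ioo (-lam) lam, f =ᶠ[𝓝 x] fun y ↦ C * g y := by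
    intro x hx
    filter_upwards [Ioo_mem_nhds hx.1 hx.2] with y hy using hfIoo y hy
  have hgu : ∀ x ∈ Ioo (-lam) lam, f x = (C * a) * frobSol lam χ x := fun x hx ↦ by
    rw [hfIoo x hx, ha x hx]; ring
  have hCa : C * a ≠ 0 := mul_ne_zero hC0 ha0
  -- the zero set of `f` in `(−λ, λ)`
  have hZf : {x : ℝ | x ∈ Ioo (-lam) lam ∧ f x = 0} = Z ∪ (fun x ↦ -x) '' Z := by
    ext x
    simp only [mem_setOf_eq, mem_union, mem_image, hZ]
    constructor
    · rintro ⟨hx, hfx⟩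
      rw [hgu x hx, mul_eq_zero] at hfx
      have hux := hfx.resolve_left hCa
      rcases lt_trichotomy x 0 with h | h | h
      · refine Or.inr ⟨-x, ⟨⟨by linarith, by linarith [hx.1]⟩, ?_⟩, neg_neg x⟩
        rwa [hueven x hx]
      · exact absurd (h ▸ hux) hu0
      · exact Or.inl ⟨⟨h, hx.2⟩, hux⟩
    · rintro (⟨hx, hux⟩ | ⟨y, ⟨hy, huy⟩, rfl⟩)
      · have hx' : x ∈ Ioo (-lam) lam := ⟨by linarith [hx.1], hx.2⟩
        exact ⟨hx', by rw [hgu x hx', hux, mul_zero]⟩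
      · have hy' : -y ∈ Ioo (-lam) lam := ⟨by linarith [hy.2], by linarith [hy.1]⟩
        refine ⟨hy', ?_⟩
        rw [hgu (-y) hy', hueven y ⟨by linarith [hy.1], hy.2⟩, huy, mul_zero]
  have hgC2 : ContDiff ℝ 2 g := contDiff_two_of_hasDerivAt hg hg₁ hg₂
  have hprol : IsProlateFunction lam (2 * k) f := by
    refine ⟨hlam, ?_, ?_, ?_, ?_, ?_, ?_, ?_⟩
    · -- `C²` on `[−λ, λ]`
      exact (contDiff_const.mul hgC2).contDiffOn.congr fun x hx ↦ hfIcc x hx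
    · -- the eigen-equation with `χ`
      refine ⟨χ, fun x hx ↦ ?_⟩
      have hd1 : ∀ y ∈ Ioo (-lam) lam, deriv f y = C * g₁ y := by
        intro y hy
        rw [(hfev y hy).deriv_eq]
        exact ((hg y).const_mul C).deriv
      have hflux : deriv (fun y ↦ (lam ^ 2 - y ^ 2) * deriv f y) x =
          C * (((2 * π * lam * x) ^ 2 - χ) * g x) := by
        have hev : (fun y ↦ (lam ^ 2 - y ^ 2) * deriv f y) =ᶠ[𝓝 x]
            fun y ↦ C * ((lam ^ 2 - y ^ 2) * g₁ y) := by
          filter_upwards [Ioo_mem_nhds hx.1 hx.2] with y hy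
          rw [hd1 y hy]; ring
        rw [hev.deriv_eq]
        exact ((hsol.hasDerivAt_flux hx).const_mul C).deriv
      rw [hflux, hfIoo x hx]
      ring
    · -- support
      intro x hx
      simp only [hf, if_neg (not_le.mpr hx)]
    · rw [hZf]; exact hZfin.union (hZfin.image _)
    · rw [hZf, ncard_union_eq ?_ hZfin (hZfin.image _), ncard_image_of_injective _ neg_injective, ← hk]
      · ring
      · exact disjoint_left.mpr fun x hx ⟨y, hy, hxy⟩ ↦ by
          have := hy.1.1; have := hx.1.1; rw [← hxy] at this; linarith
    · -- normalisation
      have hcongr : EqOn (fun x ↦ f x ^ 2) (fun x ↦ C ^ 2 * g x ^ 2) (uIcc (-lam) lam) := by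
        intro x hx
        rw [uIcc_of_le (neg_lt_self hlam).le] at hx
        simp only [hfIcc x hx]
        ring
      rw [intervalIntegral.integral_congr hcongr, intervalIntegral.integral_const_mul]
      exact hC2
    · -- positivity at `0`
      have : f 0 = sgn * g 0 / Real.sqrt N := by
        rw [hfIcc 0 ⟨by linarith, hlam.le⟩, hC]; ring
      rw [this]
      exact div_pos hsgnpos hsqrt
  refine ⟨k, f, C⁻¹, hprol, fun x hx ↦ ?_⟩
  rw [hfIcc x hx]
  field_simp


/-! ## The main theorem: even eigenvectors of the sinc operator lie in the span of the prolate functions -/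

section Main

/-- The cosine moment `ξ ↦ ∫_{[−λ,λ]} T(x)cos(2πxξ)dx` of an `L¹` function is continuous. [folklore] -/
private theorem continuous_setIntegral_mul_cos {T : ℝ → ℂ} (hT : IntegrableOn T (Icc (-lam) lam)) :
    Continuous fun ξ : ℝ ↦ ∫ x in Icc (-lam) lam, T x * (Real.cos (2 * π * x * ξ) : ℂ) := by
  refine continuous_of_dominated (bound := fun x ↦ ‖T x‖) ?_ ?_ hT.norm ?_
  · intro ξ
    exact hT.aestronglyMeasurable.mul
      (by fun_prop : Continuous fun x : ℝ ↦ (Real.cos (2 * π * x * ξ) : ℂ)).aestronglyMeasurable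
  · intro ξ
    refine Eventually.of_forall fun x ↦ ?_
    rw [norm_mul, Complex.norm_real]
    exact mul_le_of_le_one_right (norm_nonneg _) (Real.abs_cos_le_one _)
  · exact Eventually.of_forall fun x ↦ by fun_prop

/-- The kernel `M(ξ, y)` of `𝐖R₀` is even in `y`. [folklore] -/
private theorem kernelM_neg (ξ y : ℝ) :
    (-(4 * π * ξ * (-y)) * Real.sin (2 * π * ξ * (-y))
        + ((lam ^ 2 - (-y) ^ 2) * (2 * π * ξ) ^ 2 + (2 * π * lam * (-y)) ^ 2) * Real.cos (2 * π * ξ * (-y)))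
      = (-(4 * π * ξ * y) * Real.sin (2 * π * ξ * y)
        + ((lam ^ 2 - y ^ 2) * (2 * π * ξ) ^ 2 + (2 * π * lam * y) ^ 2) * Real.cos (2 * π * ξ * y)) := by
  simp only [mul_neg, Real.sin_neg, Real.cos_neg]
  ring

/-- The interval integral over `[−λ,λ]` equals the set integral over `Icc (−1) 1`. [folklore] -/
private theorem setIntegral_Icc_eq (hlam : 0 < lam) (f : ℝ → ℂ) :
    ∫ x in Icc (-lam) lam, f x = ∫ x in (-lam)..lam, f x := by
  have hle : -lam ≤ lam := by linarith
  rw [integral_Icc_eq_integral_Ioc, intervalIntegral.integral_of_le hle]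

/-- **Even eigenvectors of the band-`λ` sinc operator are prolate** (steps (2)+(3) of the completeness
proof of Slepian–Pollak at a general band; the hypothesis `hstep3` of
`ProlateBand.eq_zero_of_even_of_orthogonal_prolateBand`).  For a bounded `K` on `L²[−λ,λ]` acting a.e. as
the sinc-kernel integral operator `(Kφ)(y) = ∫_{[−λ,λ]} κ_λ(y−x)φ(x)dx`, `κ_λ(v) = ∫_{−λ}^{λ} e^{2πiξv}dξ`
(written out), compact, every EVEN eigenvector with non-zero eigenvalue `ν` is a finite linear combination of
`L²([−λ,λ])` classes of even-indexed prolate functions `h_{2k,λ}` of band `λ` (the set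
`ProlateBand.prolateBandSet λ` of the companion module, written out): the eigenspace `E_ν` is
finite-dimensional (compactness), its even part is invariant under `𝐖_λ` (the commutation `[𝐖_λ, K] = 0`)
on which `𝐖_λ` is symmetric, and each `𝐖_λ`-eigenvector there is a `C²` even solution of the prolate
equation, hence a multiple of a prolate function (`exists_eq_mul_prolate`).
[cite: SlepianPollak1961, §III ("the ψ_n are complete in L²(−T/2,T/2)"); ConnesConsani2021, §4 p. 17] -/
theorem even_eigenvector_mem_span_prolateBand (hlam : 0 < lam)
    (K : Lp ℂ 2 (volume.restrict (Icc (-lam) lam)) →L[ℂ]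
      Lp ℂ 2 (volume.restrict (Icc (-lam) lam)))
    (hK : ∀ φ : Lp ℂ 2 (volume.restrict (Icc (-lam) lam)),
      (K φ : ℝ → ℂ) =ᵐ[(volume : Measure ℝ).restrict (Icc (-lam) lam)]
        fun y ↦ ∫ x in Icc (-lam) lam,
          (∫ ξ in (-lam)..lam, cexp (2 * π * I * ξ * ((y - x : ℝ) : ℂ))) * (φ : ℝ → ℂ) x)
    (hKc : IsCompactOperator K) {ν : ℝ} (hν : ν ≠ 0)
    {S : Lp ℂ 2 (volume.restrict (Icc (-lam) lam))} (hS : K S = (ν : ℂ) • S)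
    (heven : ∀ᵐ x ∂(volume.restrict (Icc (-lam) lam)), (S : ℝ → ℂ) (-x) = (S : ℝ → ℂ) x) :
    S ∈ Submodule.span ℂ {T : Lp ℂ 2 (volume.restrict (Icc (-lam) lam)) | ∃ (n : ℕ) (e : ℝ → ℝ),
      IsProlateFunction lam (2 * n) e ∧
        (T : ℝ → ℂ) =ᵐ[volume.restrict (Icc (-lam) lam)] fun x ↦ (e x : ℂ)} := by
  haveI : IsFiniteMeasure (volume.restrict (Icc (-lam) lam)) :=
    isFiniteMeasure_restrict.2 measure_Icc_lt_top.ne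
  have hνC : (ν : ℂ) ≠ 0 := by exact_mod_cast hν
  have hle : -lam ≤ lam := by linarith
  -- reflection preserves `(volume.restrict (Icc (-lam) lam))`
  have hneg : MeasurePreserving (fun x : ℝ ↦ -x) (volume.restrict (Icc (-lam) lam)) (volume.restrict (Icc (-lam) lam)) := by
    have h := (Measure.measurePreserving_neg (volume : Measure ℝ)).restrict_preimage
      (measurableSet_Icc (a := -lam) (b := lam))
    have e : (fun x : ℝ ↦ -x) ⁻¹' Icc (-lam) lam = Icc (-lam) lam := by
      ext x; simp only [mem_preimage, mem_Icc]; constructor <;> rintro ⟨h1, h2⟩ <;> constructor <;> linarith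
    rw [e] at h
    exact h
  -- integrability of `L²` functions on the finite measure `(volume.restrict (Icc (-lam) lam))`
  have hint : ∀ T : Lp ℂ 2 (volume.restrict (Icc (-lam) lam)), Integrable (T : ℝ → ℂ) (volume.restrict (Icc (-lam) lam)) := fun T ↦
    (Lp.memLp T).integrable one_le_two
  -- the cosine moment `Ĉ T` and its continuity
  have hCc : ∀ T : Lp ℂ 2 (volume.restrict (Icc (-lam) lam)), Continuous fun ξ : ℝ ↦
      ∫ x in Icc (-lam) lam, (T : ℝ → ℂ) x * (Real.cos (2 * π * x * ξ) : ℂ) := fun T ↦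
    continuous_setIntegral_mul_cos (hint T)
  -- continuous functions are in `L²((volume.restrict (Icc (-lam) lam)))`
  have hmemLp : ∀ g : ℝ → ℂ, Continuous g → MemLp g 2 (volume.restrict (Icc (-lam) lam)) := fun g hg ↦ by
    obtain ⟨C, hC⟩ := isCompact_Icc.exists_bound_of_continuousOn (hg.continuousOn (s := Icc (-lam) lam))
    exact MemLp.of_bound hg.aestronglyMeasurable C
      ((ae_restrict_iff' measurableSet_Icc).2 (Eventually.of_forall hC))
  /- the band-limited objects attached to `T ∈ L²((volume.restrict (Icc (-lam) lam)))`: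
     `Ch T ξ = ∫ T(x) cos(2πxξ) dx`, `R0 T y = ∫ Ch T ξ cos(2πξy) dξ`, `WK T y = ∫ Ch T ξ M(ξ,y) dξ = (𝐖 R0 T)(y)` -/
  set Ch : Lp ℂ 2 (volume.restrict (Icc (-lam) lam)) → ℝ → ℂ := fun T ξ ↦
    ∫ x in Icc (-lam) lam, (T : ℝ → ℂ) x * (Real.cos (2 * π * x * ξ) : ℂ) with hCh
  set R0 : Lp ℂ 2 (volume.restrict (Icc (-lam) lam)) → ℝ → ℂ := fun T y ↦
    ∫ ξ in (-lam)..lam, Ch T ξ * (Real.cos (2 * π * ξ * y) : ℂ) with hR0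
  set R1 : Lp ℂ 2 (volume.restrict (Icc (-lam) lam)) → ℝ → ℂ := fun T y ↦
    ∫ ξ in (-lam)..lam, Ch T ξ * ((-(2 * π * ξ) * Real.sin (2 * π * ξ * y) : ℝ) : ℂ) with hR1
  set R2 : Lp ℂ 2 (volume.restrict (Icc (-lam) lam)) → ℝ → ℂ := fun T y ↦
    ∫ ξ in (-lam)..lam, (Ch T ξ * ((-(2 * π * ξ) : ℝ) : ℂ)) * (((2 * π * ξ) * Real.cos (2 * π * ξ * y) : ℝ) : ℂ)
    with hR2
  set WK : Lp ℂ 2 (volume.restrict (Icc (-lam) lam)) → ℝ → ℂ := fun T y ↦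
    ∫ ξ in (-lam)..lam, Ch T ξ * ((-(4 * π * ξ * y) * Real.sin (2 * π * ξ * y)
      + ((lam ^ 2 - y ^ 2) * (2 * π * ξ) ^ 2 + (2 * π * lam * y) ^ 2) * Real.cos (2 * π * ξ * y) : ℝ) : ℂ) with hWK
  have hWK_eq : ∀ (T : Lp ℂ 2 (volume.restrict (Icc (-lam) lam))) (y : ℝ), WK T y =
      2 * (y : ℂ) * R1 T y - ((lam : ℂ) ^ 2 - (y : ℂ) ^ 2) * R2 T y + (2 * π * lam * (y : ℂ)) ^ 2 * R0 T y :=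
    fun T y ↦ (WR_eq_integral_kernel hlam (hCc T) y).symm
  have hWKc : ∀ T : Lp ℂ 2 (volume.restrict (Icc (-lam) lam)), Continuous (WK T) := fun T ↦ by
    have e : WK T = fun y : ℝ ↦ 2 * (y : ℂ) * R1 T y - ((lam : ℂ) ^ 2 - (y : ℂ) ^ 2) * R2 T y
        + (2 * π * lam * (y : ℂ)) ^ 2 * R0 T y := funext (hWK_eq T)
    rw [e]
    exact continuous_WR hlam (hCc T)
  have hWK_even : ∀ (T : Lp ℂ 2 (volume.restrict (Icc (-lam) lam))) (y : ℝ), WK T (-y) = WK T y := fun T y ↦ by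
    simp only [hWK]
    refine intervalIntegral.integral_congr fun ξ _ ↦ ?_
    simp only [kernelM_neg]
  -- linearity of `T ↦ Ch T` and `T ↦ WK T`
  have hCh_int : ∀ (T : Lp ℂ 2 (volume.restrict (Icc (-lam) lam))) (ξ : ℝ),
      Integrable (fun x ↦ (T : ℝ → ℂ) x * (Real.cos (2 * π * x * ξ) : ℂ)) (volume.restrict (Icc (-lam) lam)) := fun T ξ ↦
    (hint T).mul_bdd (c := 1) (by fun_prop : Continuous fun x : ℝ ↦ (Real.cos (2 * π * x * ξ) : ℂ)).aestronglyMeasurable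
      (Eventually.of_forall fun x ↦ by rw [Complex.norm_real]; exact Real.abs_cos_le_one _)
  have hCh_add : ∀ (T₁ T₂ : Lp ℂ 2 (volume.restrict (Icc (-lam) lam))) (ξ : ℝ), Ch (T₁ + T₂) ξ = Ch T₁ ξ + Ch T₂ ξ := fun T₁ T₂ ξ ↦ by
    simp only [hCh]
    rw [← integral_add (hCh_int T₁ ξ) (hCh_int T₂ ξ)]
    refine integral_congr_ae ?_
    filter_upwards [Lp.coeFn_add T₁ T₂] with x hx
    rw [hx, Pi.add_apply, add_mul]
  have hCh_smul : ∀ (a : ℂ) (T : Lp ℂ 2 (volume.restrict (Icc (-lam) lam))) (ξ : ℝ), Ch (a • T) ξ = a * Ch T ξ := fun a T ξ ↦ by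
    simp only [hCh]
    rw [← integral_const_mul]
    refine integral_congr_ae ?_
    filter_upwards [Lp.coeFn_smul a T] with x hx
    rw [hx, Pi.smul_apply, smul_eq_mul, mul_assoc]
  have hM_int : ∀ (T : Lp ℂ 2 (volume.restrict (Icc (-lam) lam))) (y : ℝ), IntervalIntegrable (fun ξ ↦ Ch T ξ *
      ((-(4 * π * ξ * y) * Real.sin (2 * π * ξ * y)
        + ((lam ^ 2 - y ^ 2) * (2 * π * ξ) ^ 2 + (2 * π * lam * y) ^ 2) * Real.cos (2 * π * ξ * y) : ℝ) : ℂ))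
      volume (-lam) lam := fun T y ↦
    ((hCc T).mul (by fun_prop)).continuousOn.intervalIntegrable_of_Icc hle
  have hWK_add : ∀ (T₁ T₂ : Lp ℂ 2 (volume.restrict (Icc (-lam) lam))) (y : ℝ), WK (T₁ + T₂) y = WK T₁ y + WK T₂ y := fun T₁ T₂ y ↦ by
    simp only [hWK]
    rw [← intervalIntegral.integral_add (hM_int T₁ y) (hM_int T₂ y)]
    refine intervalIntegral.integral_congr fun ξ _ ↦ ?_
    simp only [hCh_add, add_mul]
  have hWK_smul : ∀ (a : ℂ) (T : Lp ℂ 2 (volume.restrict (Icc (-lam) lam))) (y : ℝ), WK (a • T) y = a * WK T y := fun a T y ↦ by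
    simp only [hWK]
    rw [← intervalIntegral.integral_const_mul]
    refine intervalIntegral.integral_congr fun ξ _ ↦ ?_
    simp only [hCh_smul, mul_assoc]
  -- the linear map `Φ : T ↦ ν⁻¹ 𝐖 R₀ T` on `L²((volume.restrict (Icc (-lam) lam)))`
  have hΦmem : ∀ T : Lp ℂ 2 (volume.restrict (Icc (-lam) lam)), MemLp (fun y ↦ (ν : ℂ)⁻¹ * WK T y) 2 (volume.restrict (Icc (-lam) lam)) := fun T ↦
    hmemLp _ (continuous_const.mul (hWKc T))
  set Φ : Lp ℂ 2 (volume.restrict (Icc (-lam) lam)) →ₗ[ℂ] Lp ℂ 2 (volume.restrict (Icc (-lam) lam)) :=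
    { toFun := fun T ↦ (hΦmem T).toLp _
      map_add' := fun T₁ T₂ ↦ by
        apply Lp.ext
        filter_upwards [(hΦmem (T₁ + T₂)).coeFn_toLp, (hΦmem T₁).coeFn_toLp, (hΦmem T₂).coeFn_toLp,
          Lp.coeFn_add ((hΦmem T₁).toLp _) ((hΦmem T₂).toLp _)] with y h1 h2 h3 h4
        rw [h1, h4, Pi.add_apply, h2, h3, hWK_add, mul_add]
      map_smul' := fun a T ↦ by
        apply Lp.ext
        filter_upwards [(hΦmem (a • T)).coeFn_toLp, (hΦmem T).coeFn_toLp,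
          Lp.coeFn_smul a ((hΦmem T).toLp _)] with y h1 h2 h3
        rw [RingHom.id_apply, h1, h3, Pi.smul_apply, h2, hWK_smul, smul_eq_mul]
        ring } with hΦ
  have hΦcoe : ∀ T : Lp ℂ 2 (volume.restrict (Icc (-lam) lam)), (Φ T : ℝ → ℂ) =ᵐ[(volume.restrict (Icc (-lam) lam))] fun y ↦ (ν : ℂ)⁻¹ * WK T y := fun T ↦
    (hΦmem T).coeFn_toLp
  /- the finite-dimensional space `F = E_ν ∩ (even functions)` -/
  set E : Submodule ℂ (Lp ℂ 2 (volume.restrict (Icc (-lam) lam))) :=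
    Module.End.eigenspace (K : Lp ℂ 2 (volume.restrict (Icc (-lam) lam)) →ₗ[ℂ] Lp ℂ 2 (volume.restrict (Icc (-lam) lam))) (ν : ℂ) with hE
  haveI hEfd : FiniteDimensional ℂ E :=
    ContinuousLinearMap.finite_dimensional_eigenspace hKc (ν : ℂ) hνC
  set Ev : Submodule ℂ (Lp ℂ 2 (volume.restrict (Icc (-lam) lam))) :=
    { carrier := {T | ∀ᵐ x ∂(volume.restrict (Icc (-lam) lam)), (T : ℝ → ℂ) (-x) = (T : ℝ → ℂ) x}
      add_mem' := by
        intro T₁ T₂ h₁ h₂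
        simp only [Set.mem_setOf_eq] at h₁ h₂ ⊢
        have h := Lp.coeFn_add T₁ T₂
        filter_upwards [h₁, h₂, h, hneg.quasiMeasurePreserving.ae_eq_comp h] with x hx1 hx2 hx hx'
        simp only [Function.comp_apply] at hx'
        rw [hx', hx, Pi.add_apply, Pi.add_apply, hx1, hx2]
      zero_mem' := by
        simp only [Set.mem_setOf_eq]
        have h := Lp.coeFn_zero ℂ 2 (volume.restrict (Icc (-lam) lam))
        filter_upwards [h, hneg.quasiMeasurePreserving.ae_eq_comp h] with x hx hx'
        simp only [Function.comp_apply] at hx'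
        rw [hx', hx]
        rfl
      smul_mem' := by
        intro a T hT
        simp only [Set.mem_setOf_eq] at hT ⊢
        have h := Lp.coeFn_smul a T
        filter_upwards [hT, h, hneg.quasiMeasurePreserving.ae_eq_comp h] with x hx1 hx hx'
        simp only [Function.comp_apply] at hx'
        rw [hx', hx, Pi.smul_apply, Pi.smul_apply, hx1] } with hEv
  set F : Submodule ℂ (Lp ℂ 2 (volume.restrict (Icc (-lam) lam))) := E ⊓ Ev with hF
  haveI hFfd : FiniteDimensional ℂ F := Submodule.finiteDimensional_of_le inf_le_left
  have hmemF : ∀ {T : Lp ℂ 2 (volume.restrict (Icc (-lam) lam))}, T ∈ F ↔ K T = (ν : ℂ) • T ∧ ∀ᵐ x ∂(volume.restrict (Icc (-lam) lam)), (T : ℝ → ℂ) (-x) = (T : ℝ → ℂ) x := by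
    intro T
    rw [hF, Submodule.mem_inf, hE, Module.End.mem_eigenspace_iff]
    rfl
  have hSF : S ∈ F := hmemF.2 ⟨hS, heven⟩
  /- the band-limited representative: `T = ν⁻¹ R₀ T` a.e. for `T ∈ F` -/
  have hrep : ∀ T ∈ F, (T : ℝ → ℂ) =ᵐ[(volume.restrict (Icc (-lam) lam))] fun y ↦ (ν : ℂ)⁻¹ * R0 T y := by
    intro T hT
    obtain ⟨hKT, hTev⟩ := hmemF.1 hT
    have h1 := hK T
    have h2 : (K T : ℝ → ℂ) =ᵐ[(volume.restrict (Icc (-lam) lam))] fun y ↦ (ν : ℂ) * (T : ℝ → ℂ) y := by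
      rw [hKT]
      filter_upwards [Lp.coeFn_smul (ν : ℂ) T] with y hy
      rw [hy, Pi.smul_apply, smul_eq_mul]
    filter_upwards [h1, h2] with y hy1 hy2
    have hcos := integral_sinc_mul_eq_cos_cos hlam (hint T) hTev y
    rw [hy1, hcos] at hy2
    have e : (∫ ξ in (-lam)..lam, (Real.cos (2 * π * ξ * y) : ℂ)
        * ∫ x in Icc (-lam) lam, (T : ℝ → ℂ) x * (Real.cos (2 * π * x * ξ) : ℂ)) = R0 T y := by
      simp only [hR0, hCh]
      exact intervalIntegral.integral_congr fun ξ _ ↦ mul_comm _ _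
    rw [e] at hy2
    rw [hy2]
    field_simp
  /- `C(R₀T) = ν Ĉ T` for `T ∈ F` -/
  have hCD : ∀ T ∈ F, ∀ ξ : ℝ,
      ∫ x in (-lam)..lam, R0 T x * (Real.cos (2 * π * x * ξ) : ℂ) = (ν : ℂ) * Ch T ξ := by
    intro T hT ξ
    have h1 : Ch T ξ = (ν : ℂ)⁻¹ * ∫ x in (-lam)..lam, R0 T x * (Real.cos (2 * π * x * ξ) : ℂ) := by
      rw [← setIntegral_Icc_eq hlam, ← integral_const_mul]
      simp only [hCh]
      refine integral_congr_ae ?_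
      filter_upwards [hrep T hT] with x hx
      rw [hx]; ring
    rw [h1, ← mul_assoc, mul_inv_cancel₀ hνC, one_mul]
  /- `Φ` maps `F` into `F` -/
  have hΦF : ∀ T ∈ F, Φ T ∈ F := by
    intro T hT
    refine hmemF.2 ⟨?_, ?_⟩
    · apply Lp.ext
      filter_upwards [hK (Φ T), hΦcoe T, Lp.coeFn_smul (ν : ℂ) (Φ T)] with y hy1 hy2 hy3
      rw [hy1, hy3, Pi.smul_apply, hy2, smul_eq_mul]
      have hint2 : ∫ x in Icc (-lam) lam,
            (∫ ξ in (-lam)..lam, cexp (2 * π * I * ξ * ((y - x : ℝ) : ℂ))) * (Φ T : ℝ → ℂ) x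
          = ∫ x in Icc (-lam) lam,
            (∫ ξ in (-lam)..lam, cexp (2 * π * I * ξ * ((y - x : ℝ) : ℂ))) * ((ν : ℂ)⁻¹ * WK T x) := by
        refine integral_congr_ae ?_
        filter_upwards [hΦcoe T] with x hx
        rw [hx]
      rw [hint2]
      have hWint : IntegrableOn (fun x ↦ (ν : ℂ)⁻¹ * WK T x) (Icc (-lam) lam) :=
        (continuous_const.mul (hWKc T)).continuousOn.integrableOn_Icc
      have hWev : ∀ᵐ x ∂(volume.restrict (Icc (-lam) lam)), (fun x ↦ (ν : ℂ)⁻¹ * WK T x) (-x) = (fun x ↦ (ν : ℂ)⁻¹ * WK T x) x :=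
        Eventually.of_forall fun x ↦ by simp only [hWK_even]
      rw [integral_sinc_mul_eq_cos_cos hlam hWint hWev y]
      have hin : ∀ ξ : ℝ, ∫ x in Icc (-lam) lam, ((ν : ℂ)⁻¹ * WK T x) * (Real.cos (2 * π * x * ξ) : ℂ)
          = (ν : ℂ)⁻¹ * ∫ x in (-lam)..lam,
            (2 * (x : ℂ) * R1 T x - ((lam : ℂ) ^ 2 - (x : ℂ) ^ 2) * R2 T x + (2 * π * lam * (x : ℂ)) ^ 2 * R0 T x)
              * (Real.cos (2 * π * x * ξ) : ℂ) := by
        intro ξ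
        rw [setIntegral_Icc_eq hlam, ← intervalIntegral.integral_const_mul]
        refine intervalIntegral.integral_congr fun x _ ↦ ?_
        simp only [hWK_eq]; ring
      simp_rw [hin]
      have hkey : ∫ ξ in (-lam)..lam, (∫ x in (-lam)..lam,
            (2 * (x : ℂ) * R1 T x - ((lam : ℂ) ^ 2 - (x : ℂ) ^ 2) * R2 T x + (2 * π * lam * (x : ℂ)) ^ 2 * R0 T x)
              * (Real.cos (2 * π * x * ξ) : ℂ)) * (Real.cos (2 * π * ξ * y) : ℂ)
          = (ν : ℂ) * (2 * (y : ℂ) * R1 T y - ((lam : ℂ) ^ 2 - (y : ℂ) ^ 2) * R2 T y + (2 * π * lam * (y : ℂ)) ^ 2 * R0 T y) :=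
        integral_cosTransform_WR_mul_cos hlam (hCc T) hνC (hCD T hT) y
      calc ∫ ξ in (-lam)..lam, (Real.cos (2 * π * ξ * y) : ℂ) * ((ν : ℂ)⁻¹ * ∫ x in (-lam)..lam,
              (2 * (x : ℂ) * R1 T x - ((lam : ℂ) ^ 2 - (x : ℂ) ^ 2) * R2 T x + (2 * π * lam * (x : ℂ)) ^ 2 * R0 T x)
                * (Real.cos (2 * π * x * ξ) : ℂ))
          = (ν : ℂ)⁻¹ * ∫ ξ in (-lam)..lam, (∫ x in (-lam)..lam,
              (2 * (x : ℂ) * R1 T x - ((lam : ℂ) ^ 2 - (x : ℂ) ^ 2) * R2 T x + (2 * π * lam * (x : ℂ)) ^ 2 * R0 T x)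
                * (Real.cos (2 * π * x * ξ) : ℂ)) * (Real.cos (2 * π * ξ * y) : ℂ) := by
            rw [← intervalIntegral.integral_const_mul]
            exact intervalIntegral.integral_congr fun ξ _ ↦ by ring
        _ = (ν : ℂ) * ((ν : ℂ)⁻¹ * WK T y) := by rw [hkey, hWK_eq]; field_simp
    · filter_upwards [hΦcoe T, hneg.quasiMeasurePreserving.ae_eq_comp (hΦcoe T)] with x hx hx'
      simp only [Function.comp_apply] at hx'
      rw [hx', hx, hWK_even]
  /- `Φ` is symmetric on `F` -/
  have hΦsym : ∀ S' ∈ F, ∀ T' ∈ F, ⟪Φ S', T'⟫_ℂ = ⟪S', Φ T'⟫_ℂ := by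
    intro S' hS' T' hT'
    rw [MeasureTheory.L2.inner_def, MeasureTheory.L2.inner_def]
    have h1 : ∫ x, ⟪(Φ S' : ℝ → ℂ) x, (T' : ℝ → ℂ) x⟫_ℂ ∂(volume.restrict (Icc (-lam) lam))
        = ∫ x in (-lam)..lam, conj ((ν : ℂ)⁻¹ * WK S' x) * ((ν : ℂ)⁻¹ * R0 T' x) := by
      rw [← setIntegral_Icc_eq hlam]
      refine integral_congr_ae ?_
      filter_upwards [hΦcoe S', hrep T' hT'] with x hx1 hx2
      rw [RCLike.inner_apply, hx1, hx2]
      exact mul_comm _ _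
    have h2 : ∫ x, ⟪(S' : ℝ → ℂ) x, (Φ T' : ℝ → ℂ) x⟫_ℂ ∂(volume.restrict (Icc (-lam) lam))
        = ∫ x in (-lam)..lam, conj ((ν : ℂ)⁻¹ * R0 S' x) * ((ν : ℂ)⁻¹ * WK T' x) := by
      rw [← setIntegral_Icc_eq hlam]
      refine integral_congr_ae ?_
      filter_upwards [hrep S' hS', hΦcoe T'] with x hx1 hx2
      rw [RCLike.inner_apply, hx1, hx2]
      exact mul_comm _ _
    rw [h1, h2]
    have hsym : ∫ x in (-lam)..lam, conj
          (2 * (x : ℂ) * R1 S' x - ((lam : ℂ) ^ 2 - (x : ℂ) ^ 2) * R2 S' x + (2 * π * lam * (x : ℂ)) ^ 2 * R0 S' x) * R0 T' x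
        = ∫ x in (-lam)..lam, conj (R0 S' x)
          * (2 * (x : ℂ) * R1 T' x - ((lam : ℂ) ^ 2 - (x : ℂ) ^ 2) * R2 T' x + (2 * π * lam * (x : ℂ)) ^ 2 * R0 T' x) :=
      integral_conj_WR_mul_R0 hlam (hCc S') (hCc T')
    calc ∫ x in (-lam)..lam, conj ((ν : ℂ)⁻¹ * WK S' x) * ((ν : ℂ)⁻¹ * R0 T' x)
        = (conj ((ν : ℂ)⁻¹) * (ν : ℂ)⁻¹) * ∫ x in (-lam)..lam, conj
            (2 * (x : ℂ) * R1 S' x - ((lam : ℂ) ^ 2 - (x : ℂ) ^ 2) * R2 S' x + (2 * π * lam * (x : ℂ)) ^ 2 * R0 S' x)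
              * R0 T' x := by
          rw [← intervalIntegral.integral_const_mul]
          refine intervalIntegral.integral_congr fun x _ ↦ ?_
          simp only [hWK_eq, map_mul]; ring
      _ = (conj ((ν : ℂ)⁻¹) * (ν : ℂ)⁻¹) * ∫ x in (-lam)..lam, conj (R0 S' x)
            * (2 * (x : ℂ) * R1 T' x - ((lam : ℂ) ^ 2 - (x : ℂ) ^ 2) * R2 T' x + (2 * π * lam * (x : ℂ)) ^ 2 * R0 T' x) := by
          rw [hsym]
      _ = ∫ x in (-lam)..lam, conj ((ν : ℂ)⁻¹ * R0 S' x) * ((ν : ℂ)⁻¹ * WK T' x) := by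
          rw [← intervalIntegral.integral_const_mul]
          refine intervalIntegral.integral_congr fun x _ ↦ ?_
          simp only [hWK_eq, map_mul]; ring
  /- the restriction `Φ|_F` and its orthonormal eigenbasis -/
  set ΦF : F →ₗ[ℂ] F := Φ.restrict (p := F) (q := F) fun T hT ↦ hΦF T hT with hΦFdef
  have hΦFsym : ΦF.IsSymmetric := fun u w ↦ by
    rw [Submodule.coe_inner, Submodule.coe_inner]
    exact hΦsym u u.2 w w.2
  /- derivatives of real and imaginary parts -/
  have hre : ∀ {f : ℝ → ℂ} {f' : ℂ} {y : ℝ}, HasDerivAt f f' y → HasDerivAt (fun y ↦ (f y).re) f'.re y := by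
    intro f f' y h
    have C : HasFDerivAt Complex.re Complex.reCLM (f y) := Complex.reCLM.hasFDerivAt
    simpa using! (C.comp y h.hasFDerivAt).hasDerivAt
  have him : ∀ {f : ℝ → ℂ} {f' : ℂ} {y : ℝ}, HasDerivAt f f' y → HasDerivAt (fun y ↦ (f y).im) f'.im y := by
    intro f f' y h
    have C : HasFDerivAt Complex.im Complex.imCLM (f y) := Complex.imCLM.hasFDerivAt
    simpa using! (C.comp y h.hasFDerivAt).hasDerivAt
  have hmemI : ∀ᵐ y ∂(volume.restrict (Icc (-lam) lam)), y ∈ Icc (-lam) lam :=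
    ae_restrict_mem measurableSet_Icc
  /- `L²([−λ,λ])` classes of prolate functions -/
  have hmemLpE : ∀ {m : ℕ} {e : ℝ → ℝ}, IsProlateFunction lam m e →
      MemLp (fun y ↦ (e y : ℂ)) 2 (volume.restrict (Icc (-lam) lam)) := by
    intro m e he
    have hc : ContinuousOn (fun y ↦ (e y : ℂ)) (Icc (-lam) lam) :=
      Complex.continuous_ofReal.comp_continuousOn he.contDiffOn.continuousOn
    obtain ⟨C, hC⟩ := isCompact_Icc.exists_bound_of_continuousOn hc
    exact MemLp.of_bound (hc.aestronglyMeasurable measurableSet_Icc) C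
      ((ae_restrict_iff' measurableSet_Icc).2 (Eventually.of_forall hC))
  /- each `Φ`-eigenvector in `F` is a combination of (at most two) prolate functions -/
  have hEIG : ∀ v ∈ F, ∀ χ : ℝ, Φ v = (χ : ℂ) • v →
      v ∈ Submodule.span ℂ {T : Lp ℂ 2 (volume.restrict (Icc (-lam) lam)) | ∃ (n : ℕ) (e : ℝ → ℝ),
        IsProlateFunction lam (2 * n) e ∧
          (T : ℝ → ℂ) =ᵐ[volume.restrict (Icc (-lam) lam)] fun x ↦ (e x : ℂ)} := by
    intro v hv χ hΦv
    have hD := hCc v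
    -- the smooth representative `g = ν⁻¹ R₀ v` and its derivative data
    have hg0 : ∀ y, HasDerivAt (fun y ↦ (ν : ℂ)⁻¹ * R0 v y) ((ν : ℂ)⁻¹ * R1 v y) y := fun y ↦
      (hasDerivAt_R0 hlam hD y).const_mul _
    have hg1 : ∀ y, HasDerivAt (fun y ↦ (ν : ℂ)⁻¹ * R1 v y) ((ν : ℂ)⁻¹ * R2 v y) y := fun y ↦
      (hasDerivAt_R1 hlam hD y).const_mul _
    have hg2c : Continuous fun y ↦ (ν : ℂ)⁻¹ * R2 v y := continuous_const.mul (continuous_R2 hlam hD)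
    have hR0even : ∀ y, R0 v (-y) = R0 v y := fun y ↦ by
      simp only [hR0]
      refine intervalIntegral.integral_congr fun ξ _ ↦ ?_
      simp only [mul_neg, Real.cos_neg]
    -- the eigen-equation, a.e. and then pointwise on `[−λ, λ]`
    have hae : (fun y ↦ (ν : ℂ)⁻¹ * WK v y) =ᵐ[volume.restrict (Icc (-lam) lam)]
        fun y ↦ (χ : ℂ) * ((ν : ℂ)⁻¹ * R0 v y) := by
      have h2 : (Φ v : ℝ → ℂ) =ᵐ[volume.restrict (Icc (-lam) lam)] fun y ↦ (χ : ℂ) * (v : ℝ → ℂ) y := by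
        rw [hΦv]
        filter_upwards [Lp.coeFn_smul (χ : ℂ) v] with y hy
        rw [hy, Pi.smul_apply, smul_eq_mul]
      filter_upwards [hΦcoe v, h2, hrep v hv] with y hy1 hy2 hy3
      rw [← hy1, hy2, hy3]
    have hptw : ∀ y ∈ Icc (-lam) lam, (ν : ℂ)⁻¹ * WK v y = (χ : ℂ) * ((ν : ℂ)⁻¹ * R0 v y) :=
      Measure.eqOn_Icc_of_ae_eq volume (neg_lt_self hlam).ne hae
        (continuous_const.mul (hWKc v)).continuousOn
        (continuous_const.mul (continuous_const.mul (continuous_R0 hlam hD))).continuousOn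
    have hode : ∀ y ∈ Ioo (-lam) lam,
        ((2 * y : ℝ) : ℂ) * ((ν : ℂ)⁻¹ * R1 v y) - ((lam ^ 2 - y ^ 2 : ℝ) : ℂ) * ((ν : ℂ)⁻¹ * R2 v y)
          + (((2 * π * lam * y) ^ 2 : ℝ) : ℂ) * ((ν : ℂ)⁻¹ * R0 v y) = (χ : ℂ) * ((ν : ℂ)⁻¹ * R0 v y) := by
      intro y hy
      rw [← hptw y (Ioo_subset_Icc_self hy), hWK_eq]
      push_cast; ring
    -- real part
    obtain ⟨k₁, e₁, c₁, he₁, hk₁⟩ : ∃ (k : ℕ) (e : ℝ → ℝ) (c : ℝ), IsProlateFunction lam (2 * k) e ∧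
        ∀ y ∈ Icc (-lam) lam, ((ν : ℂ)⁻¹ * R0 v y).re = c * e y := by
      refine exists_eq_mul_prolate hlam (g := fun y ↦ ((ν : ℂ)⁻¹ * R0 v y).re)
        (g₁ := fun y ↦ ((ν : ℂ)⁻¹ * R1 v y).re) (g₂ := fun y ↦ ((ν : ℂ)⁻¹ * R2 v y).re) (χ := χ)
        (fun y ↦ hre (hg0 y)) (fun y ↦ hre (hg1 y)) (Complex.continuous_re.comp hg2c) ?_ ?_
      · refine ⟨fun y hy ↦ hre (hg0 y), fun y hy ↦ hre (hg1 y), fun y hy ↦ ?_⟩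
        have h := congrArg Complex.re (hode y hy)
        simp only [Complex.add_re, Complex.sub_re, Complex.re_ofReal_mul] at h
        linear_combination (-1 : ℝ) * h
      · intro y
        show ((ν : ℂ)⁻¹ * R0 v (-y)).re = ((ν : ℂ)⁻¹ * R0 v y).re
        rw [hR0even]
    -- imaginary part
    obtain ⟨k₂, e₂, c₂, he₂, hk₂⟩ : ∃ (k : ℕ) (e : ℝ → ℝ) (c : ℝ), IsProlateFunction lam (2 * k) e ∧
        ∀ y ∈ Icc (-lam) lam, ((ν : ℂ)⁻¹ * R0 v y).im = c * e y := by
      refine exists_eq_mul_prolate hlam (g := fun y ↦ ((ν : ℂ)⁻¹ * R0 v y).im)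
        (g₁ := fun y ↦ ((ν : ℂ)⁻¹ * R1 v y).im) (g₂ := fun y ↦ ((ν : ℂ)⁻¹ * R2 v y).im) (χ := χ)
        (fun y ↦ him (hg0 y)) (fun y ↦ him (hg1 y)) (Complex.continuous_im.comp hg2c) ?_ ?_
      · refine ⟨fun y hy ↦ him (hg0 y), fun y hy ↦ him (hg1 y), fun y hy ↦ ?_⟩
        have h := congrArg Complex.im (hode y hy)
        simp only [Complex.add_im, Complex.sub_im, Complex.im_ofReal_mul] at h
        linear_combination (-1 : ℝ) * h
      · intro y
        show ((ν : ℂ)⁻¹ * R0 v (-y)).im = ((ν : ℂ)⁻¹ * R0 v y).im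
        rw [hR0even]
    -- `v = c₁ e₁ + i c₂ e₂` in `L²`
    set T₁ : Lp ℂ 2 (volume.restrict (Icc (-lam) lam)) := (hmemLpE he₁).toLp _ with hT₁
    set T₂ : Lp ℂ 2 (volume.restrict (Icc (-lam) lam)) := (hmemLpE he₂).toLp _ with hT₂
    have hT₁c : (T₁ : ℝ → ℂ) =ᵐ[volume.restrict (Icc (-lam) lam)] fun y ↦ (e₁ y : ℂ) :=
      (hmemLpE he₁).coeFn_toLp
    have hT₂c : (T₂ : ℝ → ℂ) =ᵐ[volume.restrict (Icc (-lam) lam)] fun y ↦ (e₂ y : ℂ) :=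
      (hmemLpE he₂).coeFn_toLp
    have hv_eq : v = (c₁ : ℂ) • T₁ + ((c₂ : ℂ) * I) • T₂ := by
      apply Lp.ext
      filter_upwards [hrep v hv, hmemI, Lp.coeFn_add ((c₁ : ℂ) • T₁) (((c₂ : ℂ) * I) • T₂),
        Lp.coeFn_smul (c₁ : ℂ) T₁, Lp.coeFn_smul ((c₂ : ℂ) * I) T₂, hT₁c, hT₂c]
        with y h1 h2 h3 h4 h5 h6 h7
      rw [h1, h3, Pi.add_apply, h4, h5, Pi.smul_apply, Pi.smul_apply, h6, h7, smul_eq_mul, smul_eq_mul,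
        ← Complex.re_add_im ((ν : ℂ)⁻¹ * R0 v y), hk₁ y h2, hk₂ y h2]
      push_cast
      ring
    rw [hv_eq]
    exact Submodule.add_mem _ (Submodule.smul_mem _ _ (Submodule.subset_span ⟨k₁, e₁, he₁, hT₁c⟩))
      (Submodule.smul_mem _ _ (Submodule.subset_span ⟨k₂, e₂, he₂, hT₂c⟩))
  /- conclusion: expand `S` in the orthonormal eigenbasis of `Φ|_F` -/
  set b := hΦFsym.eigenvectorBasis (n := Module.finrank ℂ F) rfl with hb
  have hbmem : ∀ i, (b i : Lp ℂ 2 (volume.restrict (Icc (-lam) lam))) ∈ Submodule.span ℂ {T : Lp ℂ 2 (volume.restrict (Icc (-lam) lam)) | ∃ (n : ℕ) (e : ℝ → ℝ),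
      IsProlateFunction lam (2 * n) e ∧
        (T : ℝ → ℂ) =ᵐ[volume.restrict (Icc (-lam) lam)] fun x ↦ (e x : ℂ)} := fun i ↦ by
    have h1 := hΦFsym.apply_eigenvectorBasis (n := Module.finrank ℂ F) rfl i
    have h2 : Φ (b i : Lp ℂ 2 (volume.restrict (Icc (-lam) lam)))
        = ((hΦFsym.eigenvalues (n := Module.finrank ℂ F) rfl i : ℝ) : ℂ)
          • (b i : Lp ℂ 2 (volume.restrict (Icc (-lam) lam))) := by
      have h3 := congrArg Subtype.val h1
      have h4 : (ΦF (b i) : Lp ℂ 2 (volume.restrict (Icc (-lam) lam)))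
          = Φ (b i : Lp ℂ 2 (volume.restrict (Icc (-lam) lam))) := LinearMap.coe_restrict_apply _ _
      rw [← h4, hb, h3, Submodule.coe_smul]
      rfl
    exact hEIG _ (b i).2 _ h2
  have key : ∀ w : F, (w : Lp ℂ 2 (volume.restrict (Icc (-lam) lam))) ∈ Submodule.span ℂ {T : Lp ℂ 2 (volume.restrict (Icc (-lam) lam)) | ∃ (n : ℕ) (e : ℝ → ℝ),
      IsProlateFunction lam (2 * n) e ∧
        (T : ℝ → ℂ) =ᵐ[volume.restrict (Icc (-lam) lam)] fun x ↦ (e x : ℂ)} := fun w ↦ by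
    rw [← b.sum_repr w, Submodule.coe_sum]
    exact Submodule.sum_mem _ fun i _ ↦ by
      rw [Submodule.coe_smul]; exact Submodule.smul_mem _ _ (hbmem i)
  exact key ⟨S, hSF⟩

end Main

end ProlateBand

end Literature.NumberTheory.LFunctions
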